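import Literature.NumberTheory.ModularForms.SiegelCuspStabilizer
import Literature.NumberTheory.ModularForms.SiegelFundamentalDomainVolume
import HarnessLib

/-!
# Siegel's fundamental domain `F₂` of `Sp₄(ℤ)`: every orbit meets it, and overlaps are null

Stage 4 of the bottom-up proof of Siegel's volume formula
`Literature.NumberTheory.ModularForms.Siegel1943_vol_F2` (`vol(F₂) = π³/270`; [cite: Klingen1990,
Ch. I §3]). For the set `siegelFundamentalDomainTwo ⊂ ℝ⁶` of the fact (Minkowski-reduced `Y`,
`|x_ij| ≤ 1/2`, `|det(CZ + D)| ≥ 1` for all rank-2 symmetric integral pairs `(C, D)`) we PROVE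
(no named facts) the two properties of a Siegel fundamental domain (Klingen I.3 Thms. 1–2):

* `covers_F2` — **every `Sp₄(ℤ)`-orbit in `H₂` meets `F₂`**: existence of a point of maximal
  height (`exists_smul_pv_ge_one`), via (i) the cocycle `det(P γ⟨Z⟩ + Q) = det(P'Z + Q')/det(CZ+D)`
  (`pairDet_smul`), (ii) the Gram identity `det Y · |det(CZ+D)|² = N[r₁]N[r₂] - N(r₁,r₂)² - det Y² ω²`
  for the majorant form `N = det Y · (Y[c] + Y⁻¹[Xc + d])` (`detY_mul_pv`, by `ring`), (iii) its
  coercivity (`NqR_ge`, from `kappa_mul_le_pForm`), (iv) Lagrange reduction of binary forms over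
  `ℤ` (`lagrange_reduction`) giving a finite search set and a minimizing pair (`exists_min_pair`),
  (v) an elementary symplectic completion of the minimizing pair (`exists_sp4Z_min`, Bezout + the
  minimality); then Minkowski reduction of `Y` by `u(V) = (V 0; 0 V⁻ᵀ)`, the reflection
  `diag(1,-1,1,-1)` and integral translations (`exists_uEl_reduce`, `covers_F2`).
* `ae_unique_F2` — **if `p, γ p ∈ F₂` then `γ = ±1`, for a.e. `p`**: `|det(C_γ Z + D_γ)| = 1`
  (`pv_bottom_eq_one_of_mem`), the sets `{|det(CZ+D)| = 1}` for rank-2 pairs with `C ≠ 0` are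
  Lebesgue-null (`volume_pv_eq_one_null`: `det(CZ+D)` is affine in one of `x₀, x₁, x₂` with a
  coefficient that is nonzero or vanishes on a hyperplane; sections are finite root sets of
  quadratics; Fubini via `MeasurableEquiv.piFinSuccAbove`), and for `C_γ = 0` the strict Minkowski
  reduction forces `A = ±1` (`A_eq_pm_one`) and then `B = 0` (`ae_unique_F2`).

## References

* H. Klingen, *Introductory Lectures on Siegel Modular Forms*, CUP 1990, Ch. I §§2–3
  (Minkowski reduction, Thms. 1–2 of §3). [Klingen1990]
* C. L. Siegel, *Symplectic geometry*, Amer. J. Math. 65 (1943), §§36–39.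
* E. Gottschling, *Explizite Bestimmung der Randflächen des Fundamentalbereiches der Modulgruppe
  zweiten Grades*, Math. Ann. 138 (1959).
-/

noncomputable section

namespace Literature.NumberTheory.ModularForms.Sp4Covolume

open Complex Matrix

/-! ### Integral pairs `(C, D)`, their minors, and `|det(CZ + D)|²` -/

/-- `2 × 2` integer matrices. [folklore] -/
abbrev M2Z := Matrix (Fin 2) (Fin 2) ℤ

/-- Complexification of an integer matrix. [folklore] -/
def cZ (C : M2Z) : Matrix (Fin 2) (Fin 2) ℂ := (Int.castRingHom ℂ).mapMatrix C

/-- Entries of the complexification. [folklore] -/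
@[simp] theorem cZ_apply (C : M2Z) (i j : Fin 2) : cZ C i j = (C i j : ℂ) := rfl
/-- `cZ` is multiplicative. [folklore] -/
theorem cZ_mul (C D : M2Z) : cZ (C * D) = cZ C * cZ D := map_mul _ _ _
/-- `cZ` is additive. [folklore] -/
theorem cZ_add (C D : M2Z) : cZ (C + D) = cZ C + cZ D := map_add _ _ _
/-- `cZ 1 = 1`. [folklore] -/
theorem cZ_one : cZ 1 = 1 := map_one _
/-- `cZ 0 = 0`. [folklore] -/
theorem cZ_zero : cZ 0 = 0 := map_zero _

variable {x : Fin 6 → ℝ}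

/-- `det(CZ + D)`. [folklore] -/
def pairDet (C D : M2Z) (x : Fin 6 → ℝ) : ℂ := (cZ C * toZ x + cZ D).det

/-- `|det(CZ + D)|²`. [folklore] -/
def pv (C D : M2Z) (x : Fin 6 → ℝ) : ℝ := Complex.normSq (pairDet C D x)

/-- (K1) Left multiplication: `det(U(CZ+D)) = det U · det(CZ+D)`. [folklore] -/
theorem pairDet_mul_left (V C D : M2Z) (x : Fin 6 → ℝ) :
    pairDet (V * C) (V * D) x = (V.det : ℂ) * pairDet C D x := by
  unfold pairDet
  rw [cZ_mul, cZ_mul, Matrix.mul_assoc, ← Matrix.mul_add, Matrix.det_mul]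
  congr 1
  unfold cZ
  rw [← RingHom.map_det]
  simp

/-- (K1) `|det(V(CZ+D))|² = (det V)² |det(CZ+D)|²`. [folklore] -/
theorem pv_mul_left (V C D : M2Z) (x : Fin 6 → ℝ) :
    pv (V * C) (V * D) x = (V.det : ℝ) ^ 2 * pv C D x := by
  unfold pv
  rw [pairDet_mul_left, Complex.normSq_mul]
  congr 1
  rw [← Complex.ofReal_intCast, Complex.normSq_ofReal]
  ring

/-! ### The integer blocks of `γ ∈ Sp₄(ℤ)` and the row relations -/

/-- Integer blocks. [folklore] -/
def zA (γ : Sp4Z) : M2Z := (γ : Matrix (Fin 2 ⊕ Fin 2) (Fin 2 ⊕ Fin 2) ℤ).toBlocks₁₁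
/-- The integer `B`-block. [folklore] -/
def zB (γ : Sp4Z) : M2Z := (γ : Matrix (Fin 2 ⊕ Fin 2) (Fin 2 ⊕ Fin 2) ℤ).toBlocks₁₂
/-- The integer `C`-block. [folklore] -/
def zC (γ : Sp4Z) : M2Z := (γ : Matrix (Fin 2 ⊕ Fin 2) (Fin 2 ⊕ Fin 2) ℤ).toBlocks₂₁
/-- The integer `D`-block. [folklore] -/
def zD (γ : Sp4Z) : M2Z := (γ : Matrix (Fin 2 ⊕ Fin 2) (Fin 2 ⊕ Fin 2) ℤ).toBlocks₂₂

/-- `γ` from its integer blocks. [folklore] -/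
theorem eq_fromBlocks_z (γ : Sp4Z) :
    (γ : Matrix (Fin 2 ⊕ Fin 2) (Fin 2 ⊕ Fin 2) ℤ) = fromBlocks (zA γ) (zB γ) (zC γ) (zD γ) :=
  (fromBlocks_toBlocks _).symm

/-- Row relations: `A Bᵀ = B Aᵀ`, `C Dᵀ = D Cᵀ`, `A Dᵀ - B Cᵀ = 1`. [folklore] -/
theorem row_rel (γ : Sp4Z) :
    zA γ * (zB γ)ᵀ = zB γ * (zA γ)ᵀ ∧ zC γ * (zD γ)ᵀ = zD γ * (zC γ)ᵀ ∧
      zA γ * (zD γ)ᵀ - zB γ * (zC γ)ᵀ = 1 := by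
  have ht : (γ : Matrix (Fin 2 ⊕ Fin 2) (Fin 2 ⊕ Fin 2) ℤ)ᵀ ∈ Matrix.symplecticGroup (Fin 2) ℤ :=
    SymplecticGroup.transpose_mem γ.2
  rw [eq_fromBlocks_z, fromBlocks_transpose] at ht
  obtain ⟨h1, h2, h3⟩ := SymplecticGroup.fromBlocks_mem_iff.1 ht
  simp only [transpose_transpose] at h1 h2 h3
  exact ⟨h1, h2, h3⟩

/-- `cA (toR γ)` is the complexified integer block. [folklore] -/
theorem cA_toR (γ : Sp4Z) : cA (toR γ) = cZ (zA γ) := by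
  unfold cA blkA; rw [coe_toR]
  ext i j; simp [zA, cZ, Matrix.toBlocks₁₁]

/-- `cB (toR γ)` is the complexified integer block. [folklore] -/
theorem cB_toR (γ : Sp4Z) : cB (toR γ) = cZ (zB γ) := by
  unfold cB blkB; rw [coe_toR]
  ext i j; simp [zB, cZ, Matrix.toBlocks₁₂]

/-- `cC (toR γ)` is the complexified integer block. [folklore] -/
theorem cC_toR (γ : Sp4Z) : cC (toR γ) = cZ (zC γ) := by
  unfold cC blkC; rw [coe_toR]
  ext i j; simp [zC, cZ, Matrix.toBlocks₂₁]

/-- `cD (toR γ)` is the complexified integer block. [folklore] -/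
theorem cD_toR (γ : Sp4Z) : cD (toR γ) = cZ (zD γ) := by
  unfold cD blkD; rw [coe_toR]
  ext i j; simp [zD, cZ, Matrix.toBlocks₂₂]

/-- `Q_γ = C_γ Z + D_γ` with integer blocks. [folklore] -/
theorem matQ_toR (γ : Sp4Z) (x : Fin 6 → ℝ) : matQ (toR γ) x = cZ (zC γ) * toZ x + cZ (zD γ) := by
  unfold matQ; rw [cC_toR, cD_toR]

/-- `P_γ = A_γ Z + B_γ` with integer blocks. [folklore] -/
theorem matP_toR (γ : Sp4Z) (x : Fin 6 → ℝ) : matP (toR γ) x = cZ (zA γ) * toZ x + cZ (zB γ) := by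
  unfold matP; rw [cA_toR, cB_toR]

/-- `|det Q_γ|² = pv (C_γ) (D_γ)`. [folklore] -/
theorem pv_bottom (γ : Sp4Z) (x : Fin 6 → ℝ) : pv (zC γ) (zD γ) x = Complex.normSq (matQ (toR γ) x).det := by
  rw [pv, pairDet, matQ_toR]

/-- (K2) **Transformation of pairs**: `P γ⟨Z⟩ + Q = ((PA + QC) Z + (PB + QD)) · Q_γ(Z)⁻¹`. [folklore] -/
theorem pair_smul (γ : Sp4Z) (P Q : M2Z) (hx : x ∈ U) :
    cZ P * smulZ (toR γ) x + cZ Q =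
      (cZ (P * zA γ + Q * zC γ) * toZ x + cZ (P * zB γ + Q * zD γ)) * (matQ (toR γ) x)⁻¹ := by
  have hQ := matQ_mul_inv (toR γ) hx
  have e1 : cZ P * smulZ (toR γ) x + cZ Q = (cZ P * matP (toR γ) x + cZ Q * matQ (toR γ) x) *
      (matQ (toR γ) x)⁻¹ := by
    rw [Matrix.add_mul, Matrix.mul_assoc, Matrix.mul_assoc, hQ, Matrix.mul_one]
    rfl
  rw [e1, matP_toR, matQ_toR, cZ_add, cZ_add, cZ_mul, cZ_mul, cZ_mul, cZ_mul]
  congr 1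
  simp only [Matrix.mul_add, Matrix.add_mul, Matrix.mul_assoc]
  abel

/-- (K2) for determinants: `det(P γ⟨Z⟩ + Q) = det(P'Z + Q') / det Q_γ(Z)`. [cite: Klingen1990, Ch. I §1 (cocycle of `det(CZ+D)`)] -/
theorem pairDet_smul (γ : Sp4Z) (P Q : M2Z) (hx : x ∈ U) :
    pairDet P Q (smulVec (toR γ) x) =
      pairDet (P * zA γ + Q * zC γ) (P * zB γ + Q * zD γ) x / (matQ (toR γ) x).det := by
  have hd := det_matQ_ne_zero (toR γ) hx
  unfold pairDet
  rw [toZ_smulVec _ hx, pair_smul γ P Q hx, Matrix.det_mul, Matrix.det_nonsing_inv,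
    Ring.inverse_eq_inv', div_eq_mul_inv]

/-- (K2') `pv P Q (γ p) = pv (P') (Q') p / pv (C_γ) (D_γ) p`. [folklore] -/
theorem pv_smul (γ : Sp4Z) (P Q : M2Z) (hx : x ∈ U) :
    pv P Q (smulVec (toR γ) x) =
      pv (P * zA γ + Q * zC γ) (P * zB γ + Q * zD γ) x / pv (zC γ) (zD γ) x := by
  rw [pv, pairDet_smul γ P Q hx, Complex.normSq_div, pv_bottom, ← pv]

/-! ### Isotropy and independence of pairs -/

/-- Symmetric (isotropic) pairs: `C Dᵀ = D Cᵀ`. [folklore] -/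
def IsIso (C D : M2Z) : Prop := C * Dᵀ = D * Cᵀ

/-- The `2 × 4` row matrix `(C D)`. [folklore] -/
def rowMat (C D : M2Z) : Matrix (Fin 2) (Fin 2 ⊕ Fin 2) ℤ := fromCols C D

/-- The `2 × 2` minors of `(C D)`. [folklore] -/
def minor (C D : M2Z) (j k : Fin 2 ⊕ Fin 2) : ℤ :=
  rowMat C D 0 j * rowMat C D 1 k - rowMat C D 0 k * rowMat C D 1 j

/-- Rank two: some minor is nonzero. [folklore] -/
def Indep (C D : M2Z) : Prop := ∃ j k, minor C D j k ≠ 0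

/-- Rank-2 symmetric integral pairs. [folklore] -/
structure IsPair (C D : M2Z) : Prop where
  iso : IsIso C D
  indep : Indep C D

/-- The row matrix of the transformed pair is `(P Q) γ`. [folklore] -/
theorem rowMat_smul_pair (γ : Sp4Z) (P Q : M2Z) :
    rowMat (P * zA γ + Q * zC γ) (P * zB γ + Q * zD γ) =
      rowMat P Q * (γ : Matrix (Fin 2 ⊕ Fin 2) (Fin 2 ⊕ Fin 2) ℤ) := by
  rw [rowMat, rowMat, eq_fromBlocks_z, fromCols_mul_fromBlocks]

/-- Isotropy is preserved: `(P Q) ↦ (P Q) γ`. [folklore] -/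
theorem isIso_smul_pair (γ : Sp4Z) {P Q : M2Z} (h : IsIso P Q) :
    IsIso (P * zA γ + Q * zC γ) (P * zB γ + Q * zD γ) := by
  obtain ⟨r1, r2, r3⟩ := row_rel γ
  unfold IsIso at h ⊢
  have r3' : zD γ * (zA γ)ᵀ - zC γ * (zB γ)ᵀ = 1 := by
    have := congrArg Matrix.transpose r3
    simpa [Matrix.transpose_sub, Matrix.transpose_mul, Matrix.transpose_one] using this
  -- expand
  simp only [Matrix.transpose_add, Matrix.transpose_mul, Matrix.add_mul, Matrix.mul_add,
    Matrix.mul_assoc]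
  -- P A Bᵀ Pᵀ + P A Dᵀ Qᵀ + Q C Bᵀ Pᵀ + Q C Dᵀ Qᵀ = P B Aᵀ Pᵀ + P B Cᵀ Qᵀ + Q D Aᵀ Pᵀ + Q D Cᵀ Qᵀ
  have e1 : P * (zA γ * ((zD γ)ᵀ * Qᵀ)) - P * (zB γ * ((zC γ)ᵀ * Qᵀ)) = P * Qᵀ := by
    rw [← Matrix.mul_assoc (zA γ), ← Matrix.mul_assoc (zB γ), ← Matrix.mul_sub, ← Matrix.sub_mul,
      r3, Matrix.one_mul]
  have e2 : Q * (zD γ * ((zA γ)ᵀ * Pᵀ)) - Q * (zC γ * ((zB γ)ᵀ * Pᵀ)) = Q * Pᵀ := by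
    rw [← Matrix.mul_assoc (zD γ), ← Matrix.mul_assoc (zC γ), ← Matrix.mul_sub, ← Matrix.sub_mul,
      r3', Matrix.one_mul]
  have e3 : P * (zA γ * ((zB γ)ᵀ * Pᵀ)) = P * (zB γ * ((zA γ)ᵀ * Pᵀ)) := by
    rw [← Matrix.mul_assoc (zA γ), ← Matrix.mul_assoc (zB γ), r1]
  have e4 : Q * (zC γ * ((zD γ)ᵀ * Qᵀ)) = Q * (zD γ * ((zC γ)ᵀ * Qᵀ)) := by
    rw [← Matrix.mul_assoc (zC γ), ← Matrix.mul_assoc (zD γ), r2]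
  have e5 : P * Qᵀ = Q * Pᵀ := h
  rw [e3, e4]
  have key : P * (zA γ * ((zD γ)ᵀ * Qᵀ)) + Q * (zC γ * ((zB γ)ᵀ * Pᵀ)) =
      Q * (zD γ * ((zA γ)ᵀ * Pᵀ)) + P * (zB γ * ((zC γ)ᵀ * Qᵀ)) :=
    sub_eq_sub_iff_add_eq_add.1 (by rw [e1, e2, e5])
  apply eq_of_sub_eq_zero
  have h0 := sub_eq_zero.2 key
  convert h0 using 1
  abel

/-! ### Minors, rank two, and their invariance -/

/-- The row matrix of `V · (C, D)`. [folklore] -/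
theorem rowMat_mul_left (V C D : M2Z) : rowMat (V * C) (V * D) = V * rowMat C D := by
  rw [rowMat, rowMat, Matrix.mul_fromCols]

/-- (m1) Minors transform by `det V` under left multiplication. [folklore] -/
theorem minor_mul_left (V C D : M2Z) (j k : Fin 2 ⊕ Fin 2) :
    minor (V * C) (V * D) j k = V.det * minor C D j k := by
  simp only [minor, rowMat_mul_left, Matrix.mul_apply, Fin.sum_univ_two, Matrix.det_fin_two]
  ring

/-- (m2) All minors vanish ⇒ the rows are linearly dependent over `ℤ`. [folklore] -/
theorem exists_vecMul_eq_zero_of_minors {C D : M2Z} (h : ∀ j k, minor C D j k = 0) :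
    ∃ w : Fin 2 → ℤ, w ≠ 0 ∧ w ᵥ* rowMat C D = 0 := by
  by_cases h1 : rowMat C D 1 = 0
  · refine ⟨![0, 1], by simp, ?_⟩
    ext j
    have := congrFun h1 j
    simp [Matrix.vecMul, dotProduct, Fin.sum_univ_two, this]
  · obtain ⟨k, hk⟩ : ∃ k, rowMat C D 1 k ≠ 0 := by
      by_contra hall; push Not at hall; exact h1 (funext hall)
    refine ⟨![rowMat C D 1 k, -rowMat C D 0 k], ?_, ?_⟩
    · intro h0; apply hk; simpa using congrFun h0 0
    · ext j
      have := h j k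
      simp only [minor] at this
      simp [Matrix.vecMul, dotProduct, Fin.sum_univ_two]
      linarith

/-- (m3) A dependency kills all minors. [folklore] -/
theorem minors_eq_zero_of_vecMul {C D : M2Z} {w : Fin 2 → ℤ} (hw : w ≠ 0)
    (h : w ᵥ* rowMat C D = 0) (j k : Fin 2 ⊕ Fin 2) : minor C D j k = 0 := by
  have hj := congrFun h j
  have hk := congrFun h k
  simp only [Matrix.vecMul, dotProduct, Fin.sum_univ_two, Pi.zero_apply] at hj hk
  simp only [minor]
  by_cases h0 : w 0 = 0
  · have h1 : w 1 ≠ 0 := by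
      intro h1; apply hw; ext i; fin_cases i <;> simp [h0, h1]
    rw [h0, zero_mul, zero_add] at hj hk
    have hj' : rowMat C D 1 j = 0 := (mul_eq_zero.1 hj).resolve_left h1
    have hk' : rowMat C D 1 k = 0 := (mul_eq_zero.1 hk).resolve_left h1
    rw [hj', hk']; ring
  · have : w 0 * (rowMat C D 0 j * rowMat C D 1 k - rowMat C D 0 k * rowMat C D 1 j) = 0 := by
      have ej : w 0 * rowMat C D 0 j = -(w 1 * rowMat C D 1 j) := by linarith
      have ek : w 0 * rowMat C D 0 k = -(w 1 * rowMat C D 1 k) := by linarith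
      calc w 0 * (rowMat C D 0 j * rowMat C D 1 k - rowMat C D 0 k * rowMat C D 1 j)
          = (w 0 * rowMat C D 0 j) * rowMat C D 1 k - (w 0 * rowMat C D 0 k) * rowMat C D 1 j := by ring
        _ = 0 := by rw [ej, ek]; ring
    exact (mul_eq_zero.1 this).resolve_left h0

/-- `γ γ⁻¹ = 1` as matrices. [folklore] -/
theorem coe_mul_inv_Sp4Z (γ : Sp4Z) :
    (γ : Matrix (Fin 2 ⊕ Fin 2) (Fin 2 ⊕ Fin 2) ℤ) * ((γ⁻¹ : Sp4Z) : Matrix _ _ ℤ) = 1 := by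
  rw [← Submonoid.coe_mul, mul_inv_cancel]; rfl

/-- (m4) Rank two is preserved by `(P Q) ↦ (P Q) γ`. [folklore] -/
theorem indep_smul_pair (γ : Sp4Z) {P Q : M2Z} (h : Indep P Q) :
    Indep (P * zA γ + Q * zC γ) (P * zB γ + Q * zD γ) := by
  by_contra hn
  simp only [Indep, not_exists, not_not] at hn
  obtain ⟨w, hw, hw0⟩ := exists_vecMul_eq_zero_of_minors hn
  rw [rowMat_smul_pair, ← Matrix.vecMul_vecMul] at hw0
  have h0 : w ᵥ* rowMat P Q = 0 := by
    have := congrArg (fun u => u ᵥ* ((γ⁻¹ : Sp4Z) : Matrix (Fin 2 ⊕ Fin 2) (Fin 2 ⊕ Fin 2) ℤ)) hw0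
    simp only [Matrix.vecMul_vecMul, Matrix.zero_vecMul] at this
    rwa [Matrix.mul_assoc, coe_mul_inv_Sp4Z, Matrix.mul_one] at this
  obtain ⟨j, k, hjk⟩ := h
  exact hjk (minors_eq_zero_of_vecMul hw h0 j k)

/-- (m5) The bottom rows of a symplectic matrix have rank two. [folklore] -/
theorem indep_bottom (γ : Sp4Z) : Indep (zC γ) (zD γ) := by
  by_contra hn
  simp only [Indep, not_exists, not_not] at hn
  obtain ⟨w, hw, hw0⟩ := exists_vecMul_eq_zero_of_minors hn
  obtain ⟨-, -, r3⟩ := row_rel γ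
  have r3' : zD γ * (zA γ)ᵀ - zC γ * (zB γ)ᵀ = 1 := by
    have := congrArg Matrix.transpose r3
    simpa [Matrix.transpose_sub, Matrix.transpose_mul, Matrix.transpose_one] using this
  rw [rowMat, Matrix.vecMul_fromCols] at hw0
  have hC : w ᵥ* zC γ = 0 := by
    ext j; simpa using congrFun hw0 (Sum.inl j)
  have hD : w ᵥ* zD γ = 0 := by
    ext j; simpa using congrFun hw0 (Sum.inr j)
  have : w ᵥ* (zD γ * (zA γ)ᵀ - zC γ * (zB γ)ᵀ) = 0 := by
    rw [Matrix.vecMul_sub, ← Matrix.vecMul_vecMul, ← Matrix.vecMul_vecMul, hC, hD]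
    simp
  rw [r3', Matrix.vecMul_one] at this
  exact hw this

/-- Pairs are preserved by `(P Q) ↦ (P Q) γ`. [folklore] -/
theorem isPair_smul_pair (γ : Sp4Z) {P Q : M2Z} (h : IsPair P Q) :
    IsPair (P * zA γ + Q * zC γ) (P * zB γ + Q * zD γ) :=
  ⟨isIso_smul_pair γ h.iso, indep_smul_pair γ h.indep⟩

/-- The bottom rows of `γ ∈ Sp₄(ℤ)` form a pair. [folklore] -/
theorem isPair_bottom (γ : Sp4Z) : IsPair (zC γ) (zD γ) := ⟨(row_rel γ).2.1, indep_bottom γ⟩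

/-- Cancelling an integer matrix of nonzero determinant on the left. [folklore] -/
theorem mul_left_cancel_of_det {V : M2Z} (hV : V.det ≠ 0) {M N : Matrix (Fin 2) (Fin 2) ℤ}
    (h : V * M = V * N) : M = N := by
  have := congrArg (fun X => V.adjugate * X) h
  simp only [← Matrix.mul_assoc, Matrix.adjugate_mul, Matrix.smul_mul, Matrix.one_mul] at this
  ext i j
  have hij := congrFun (congrFun this i) j
  simp only [Matrix.smul_apply, smul_eq_mul] at hij
  exact mul_left_cancel₀ hV hij

/-- (m7) If `(C D) = V (C' D')` with `det V ≠ 0` and `(C, D)` is a pair, so is `(C', D')`. [folklore] -/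
theorem isPair_of_mul_left {V C' D' : M2Z} (hV : V.det ≠ 0) (h : IsPair (V * C') (V * D')) :
    IsPair C' D' := by
  constructor
  · have hi := h.iso
    unfold IsIso at hi ⊢
    rw [Matrix.transpose_mul, Matrix.transpose_mul, ← Matrix.mul_assoc, ← Matrix.mul_assoc,
      Matrix.mul_assoc V C', Matrix.mul_assoc V D', Matrix.mul_assoc V, Matrix.mul_assoc V] at hi
    have h1 := mul_left_cancel_of_det hV hi
    -- C' D'ᵀ Vᵀ = D' C'ᵀ Vᵀ ⇒ cancel Vᵀ on the right via transpose
    have h2 : V * (C' * D'ᵀ)ᵀ = V * (D' * C'ᵀ)ᵀ := by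
      rw [Matrix.transpose_mul, Matrix.transpose_transpose, Matrix.transpose_mul,
        Matrix.transpose_transpose]
      have := congrArg Matrix.transpose h1
      simpa [Matrix.transpose_mul, Matrix.mul_assoc] using this
    have h3 := mul_left_cancel_of_det hV h2
    have := congrArg Matrix.transpose h3
    simpa using this
  · obtain ⟨j, k, hjk⟩ := h.indep
    rw [minor_mul_left] at hjk
    exact ⟨j, k, fun h0 => hjk (by rw [h0, mul_zero])⟩

/-- Pairs are preserved by left multiplication with `det V ≠ 0`. [folklore] -/
theorem isPair_mul_left {V C D : M2Z} (hV : V.det ≠ 0) (h : IsPair C D) : IsPair (V * C) (V * D) := by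
  constructor
  · have hi := h.iso
    unfold IsIso at hi ⊢
    rw [Matrix.transpose_mul, Matrix.transpose_mul, ← Matrix.mul_assoc, ← Matrix.mul_assoc,
      Matrix.mul_assoc V C, Matrix.mul_assoc V D, hi]
  · obtain ⟨j, k, hjk⟩ := h.indep
    exact ⟨j, k, by rw [minor_mul_left]; exact mul_ne_zero hV hjk⟩

/-! ### The majorant form `𝓜` and `|det(CZ+D)|² = det Y · det Gram_𝓜` -/

/-- `det Y · 𝓜[r]` for a row `r = (c, d)`: `det Y · Y[c] + adj(Y)[Xc + d]` (a polynomial). [folklore] -/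
def Nq (x : Fin 6 → ℝ) (c d : Fin 2 → ℤ) : ℝ :=
  (x 3 * x 5 - x 4 ^ 2) * (x 3 * c 0 ^ 2 + 2 * x 4 * c 0 * c 1 + x 5 * c 1 ^ 2) +
    (x 5 * (x 0 * c 0 + x 1 * c 1 + d 0) ^ 2 -
      2 * x 4 * (x 0 * c 0 + x 1 * c 1 + d 0) * (x 1 * c 0 + x 2 * c 1 + d 1) +
      x 3 * (x 1 * c 0 + x 2 * c 1 + d 1) ^ 2)

/-- `det Y · 𝓜(r, r')` (the polar form of `Nq`). [folklore] -/
def Nb (x : Fin 6 → ℝ) (c d c' d' : Fin 2 → ℤ) : ℝ :=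
  (x 3 * x 5 - x 4 ^ 2) * (x 3 * c 0 * c' 0 + x 4 * (c 0 * c' 1 + c 1 * c' 0) + x 5 * c 1 * c' 1) +
    (x 5 * (x 0 * c 0 + x 1 * c 1 + d 0) * (x 0 * c' 0 + x 1 * c' 1 + d' 0) -
      x 4 * ((x 0 * c 0 + x 1 * c 1 + d 0) * (x 1 * c' 0 + x 2 * c' 1 + d' 1) +
        (x 1 * c 0 + x 2 * c 1 + d 1) * (x 0 * c' 0 + x 1 * c' 1 + d' 0)) +
      x 3 * (x 1 * c 0 + x 2 * c 1 + d 1) * (x 1 * c' 0 + x 2 * c' 1 + d' 1))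

/-- The symplectic pairing of two rows: `e = c · d' - d · c'`. [folklore] -/
def omg (c d c' d' : Fin 2 → ℤ) : ℤ := c 0 * d' 0 + c 1 * d' 1 - d 0 * c' 0 - d 1 * c' 1

/-- **(K3) The Gram identity**: `det Y · |det(CZ+D)|² = Nq(r₁) Nq(r₂) - Nb(r₁,r₂)² - (det Y)² e²`. [folklore] -/
theorem detY_mul_pv (C D : M2Z) (x : Fin 6 → ℝ) :
    (x 3 * x 5 - x 4 ^ 2) * pv C D x =
      Nq x (C 0) (D 0) * Nq x (C 1) (D 1) - Nb x (C 0) (D 0) (C 1) (D 1) ^ 2 -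
        (x 3 * x 5 - x 4 ^ 2) ^ 2 * (omg (C 0) (D 0) (C 1) (D 1) : ℝ) ^ 2 := by
  simp only [pv, pairDet, Matrix.det_fin_two, Complex.normSq_apply, Nq, Nb, omg]
  simp [Literature.NumberTheory.ModularForms.Sp4Covolume.toZ, Matrix.mul_apply, Fin.sum_univ_two,
    Complex.add_re, Complex.add_im, Complex.mul_re, Complex.mul_im, Complex.sub_re, Complex.sub_im]
  ring

/-! ### The real majorant form and its coercivity -/

/-- `P_Z` on real vectors `(a; b) ∈ ℝ² × ℝ²`. [folklore] -/
def pFormR (x : Fin 6 → ℝ) (a₁ a₂ b₁ b₂ : ℝ) : ℝ :=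
  yInvForm x (a₁ - (x 0 * b₁ + x 1 * b₂)) (a₂ - (x 1 * b₁ + x 2 * b₂)) + yForm x b₁ b₂

/-- **Coercivity over `ℝ`**: `κ (|a|² + |b|²) ≤ P_Z[(a; b)]` (same proof as `kappa_mul_le_pForm`). [folklore] -/
theorem kappa_mul_le_pFormR (hx : x ∈ U) (a₁ a₂ b₁ b₂ : ℝ) :
    kappa x * (a₁ ^ 2 + a₂ ^ 2 + b₁ ^ 2 + b₂ ^ 2) ≤ pFormR x a₁ a₂ b₁ b₂ := by
  have hD := detY_pos hx
  have h5 := x5_pos hx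
  have h3 := hx.1
  have hM := xBound_nonneg x
  set w₁ : ℝ := a₁ - (x 0 * b₁ + x 1 * b₂) with hw₁
  set w₂ : ℝ := a₂ - (x 1 * b₁ + x 2 * b₂) with hw₂
  have hP : pFormR x a₁ a₂ b₁ b₂ = yInvForm x w₁ w₂ + yForm x b₁ b₂ := rfl
  have hi : w₁ ^ 2 + w₂ ^ 2 + detY x * (b₁ ^ 2 + b₂ ^ 2) ≤ (x 3 + x 5) * pFormR x a₁ a₂ b₁ b₂ := by
    rw [hP]
    linarith [sq_le_yInvForm hx w₁ w₂, detY_mul_le_yForm x b₁ b₂]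
  have hii : a₁ ^ 2 + a₂ ^ 2 ≤ 2 * (w₁ ^ 2 + w₂ ^ 2) + 2 * xBound x * (b₁ ^ 2 + b₂ ^ 2) := by
    have e1 : a₁ = w₁ + (x 0 * b₁ + x 1 * b₂) := by rw [hw₁]; ring
    have e2 : a₂ = w₂ + (x 1 * b₁ + x 2 * b₂) := by rw [hw₂]; ring
    have c1 : (x 0 * b₁ + x 1 * b₂) ^ 2 ≤ (x 0 ^ 2 + x 1 ^ 2) * (b₁ ^ 2 + b₂ ^ 2) := by
      nlinarith [sq_nonneg (x 0 * b₂ - x 1 * b₁)]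
    have c2 : (x 1 * b₁ + x 2 * b₂) ^ 2 ≤ (x 1 ^ 2 + x 2 ^ 2) * (b₁ ^ 2 + b₂ ^ 2) := by
      nlinarith [sq_nonneg (x 1 * b₂ - x 2 * b₁)]
    have s1 : a₁ ^ 2 ≤ 2 * w₁ ^ 2 + 2 * (x 0 * b₁ + x 1 * b₂) ^ 2 := by
      rw [e1]; nlinarith [sq_nonneg (w₁ - (x 0 * b₁ + x 1 * b₂))]
    have s2 : a₂ ^ 2 ≤ 2 * w₂ ^ 2 + 2 * (x 1 * b₁ + x 2 * b₂) ^ 2 := by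
      rw [e2]; nlinarith [sq_nonneg (w₂ - (x 1 * b₁ + x 2 * b₂))]
    unfold xBound
    nlinarith
  have hiii : detY x * (a₁ ^ 2 + a₂ ^ 2 + b₁ ^ 2 + b₂ ^ 2) ≤
      2 * (1 + detY x + 2 * xBound x) * (w₁ ^ 2 + w₂ ^ 2 + detY x * (b₁ ^ 2 + b₂ ^ 2)) := by
    have hw0 : 0 ≤ w₁ ^ 2 + w₂ ^ 2 := by positivity
    have hb0 : 0 ≤ b₁ ^ 2 + b₂ ^ 2 := by positivity
    have t1 := mul_le_mul_of_nonneg_left hii hD.le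
    have t2 := mul_nonneg hD.le hb0
    have t3 := mul_nonneg hM hw0
    have t4 := mul_nonneg (mul_nonneg hD.le hM) hb0
    have t5 := mul_nonneg (mul_nonneg hD.le hD.le) hb0
    linarith
  have hpos : 0 < 2 * (1 + detY x + 2 * xBound x) * (x 3 + x 5) := by positivity
  unfold kappa
  rw [div_mul_eq_mul_div, div_le_iff₀ hpos]
  calc detY x * (a₁ ^ 2 + a₂ ^ 2 + b₁ ^ 2 + b₂ ^ 2)
      ≤ 2 * (1 + detY x + 2 * xBound x) * (w₁ ^ 2 + w₂ ^ 2 + detY x * (b₁ ^ 2 + b₂ ^ 2)) := hiii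
    _ ≤ 2 * (1 + detY x + 2 * xBound x) * ((x 3 + x 5) * pFormR x a₁ a₂ b₁ b₂) :=
        mul_le_mul_of_nonneg_left hi (by positivity)
    _ = pFormR x a₁ a₂ b₁ b₂ * (2 * (1 + detY x + 2 * xBound x) * (x 3 + x 5)) := by ring

/-- The real row form `det Y · 𝓜[(c, d)]` for real rows. [folklore] -/
def NqR (x : Fin 6 → ℝ) (c₀ c₁ d₀ d₁ : ℝ) : ℝ :=
  (x 3 * x 5 - x 4 ^ 2) * (x 3 * c₀ ^ 2 + 2 * x 4 * c₀ * c₁ + x 5 * c₁ ^ 2) +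
    (x 5 * (x 0 * c₀ + x 1 * c₁ + d₀) ^ 2 -
      2 * x 4 * (x 0 * c₀ + x 1 * c₁ + d₀) * (x 1 * c₀ + x 2 * c₁ + d₁) +
      x 3 * (x 1 * c₀ + x 2 * c₁ + d₁) ^ 2)

/-- `Nq` is `NqR` on integer rows. [folklore] -/
theorem Nq_eq_NqR (x : Fin 6 → ℝ) (c d : Fin 2 → ℤ) : Nq x c d = NqR x (c 0) (c 1) (d 0) (d 1) := rfl

/-- `NqR = det Y · P_Z[(-d; c)]`. [folklore] -/
theorem NqR_eq (hx : x ∈ U) (c₀ c₁ d₀ d₁ : ℝ) :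
    NqR x c₀ c₁ d₀ d₁ = detY x * pFormR x (-d₀) (-d₁) c₀ c₁ := by
  have hD : detY x ≠ 0 := (detY_pos hx).ne'
  unfold NqR pFormR yInvForm yForm
  unfold detY at hD ⊢
  field_simp
  ring

/-- **Coercivity of `NqR`**: `det Y · κ · |r|² ≤ NqR(r)`. [folklore] -/
theorem NqR_ge (hx : x ∈ U) (c₀ c₁ d₀ d₁ : ℝ) :
    detY x * kappa x * (c₀ ^ 2 + c₁ ^ 2 + d₀ ^ 2 + d₁ ^ 2) ≤ NqR x c₀ c₁ d₀ d₁ := by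
  rw [NqR_eq hx]
  have h := kappa_mul_le_pFormR hx (-d₀) (-d₁) c₀ c₁
  have hD := detY_pos hx
  have : detY x * kappa x * (c₀ ^ 2 + c₁ ^ 2 + d₀ ^ 2 + d₁ ^ 2) =
      detY x * (kappa x * ((-d₀) ^ 2 + (-d₁) ^ 2 + c₀ ^ 2 + c₁ ^ 2)) := by ring
  rw [this]
  exact mul_le_mul_of_nonneg_left h hD.le

/-- `NqR ≥ 0`. [folklore] -/
theorem NqR_nonneg (hx : x ∈ U) (c₀ c₁ d₀ d₁ : ℝ) : 0 ≤ NqR x c₀ c₁ d₀ d₁ := by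
  have h := NqR_ge hx c₀ c₁ d₀ d₁
  have : 0 ≤ detY x * kappa x * (c₀ ^ 2 + c₁ ^ 2 + d₀ ^ 2 + d₁ ^ 2) := by
    have := detY_pos hx; have := kappa_pos hx; positivity
  linarith

/-- `NqR(r) = 0 ⇒ r = 0`. [folklore] -/
theorem NqR_eq_zero (hx : x ∈ U) {c₀ c₁ d₀ d₁ : ℝ} (h : NqR x c₀ c₁ d₀ d₁ = 0) :
    c₀ = 0 ∧ c₁ = 0 ∧ d₀ = 0 ∧ d₁ = 0 := by
  have hb := NqR_ge hx c₀ c₁ d₀ d₁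
  rw [h] at hb
  have hpos : 0 < detY x * kappa x := mul_pos (detY_pos hx) (kappa_pos hx)
  have hs : c₀ ^ 2 + c₁ ^ 2 + d₀ ^ 2 + d₁ ^ 2 ≤ 0 := by
    by_contra hc; push Not at hc
    have := mul_pos hpos hc
    linarith
  refine ⟨?_, ?_, ?_, ?_⟩ <;> nlinarith [sq_nonneg c₀, sq_nonneg c₁, sq_nonneg d₀, sq_nonneg d₁]

/-- The real polar form. [folklore] -/
def NbR (x : Fin 6 → ℝ) (c₀ c₁ d₀ d₁ c₀' c₁' d₀' d₁' : ℝ) : ℝ :=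
  (x 3 * x 5 - x 4 ^ 2) * (x 3 * c₀ * c₀' + x 4 * (c₀ * c₁' + c₁ * c₀') + x 5 * c₁ * c₁') +
    (x 5 * (x 0 * c₀ + x 1 * c₁ + d₀) * (x 0 * c₀' + x 1 * c₁' + d₀') -
      x 4 * ((x 0 * c₀ + x 1 * c₁ + d₀) * (x 1 * c₀' + x 2 * c₁' + d₁') +
        (x 1 * c₀ + x 2 * c₁ + d₁) * (x 0 * c₀' + x 1 * c₁' + d₀')) +
      x 3 * (x 1 * c₀ + x 2 * c₁ + d₁) * (x 1 * c₀' + x 2 * c₁' + d₁'))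

/-- `Nb` is `NbR` on integer rows. [folklore] -/
theorem Nb_eq_NbR (x : Fin 6 → ℝ) (c d c' d' : Fin 2 → ℤ) :
    Nb x c d c' d' = NbR x (c 0) (c 1) (d 0) (d 1) (c' 0) (c' 1) (d' 0) (d' 1) := rfl

/-- Quadratic expansion `N[a r + b r'] = a² N[r] + 2ab N(r, r') + b² N[r']`. [folklore] -/
theorem NqR_lin (x : Fin 6 → ℝ) (a b c₀ c₁ d₀ d₁ c₀' c₁' d₀' d₁' : ℝ) :
    NqR x (a * c₀ + b * c₀') (a * c₁ + b * c₁') (a * d₀ + b * d₀') (a * d₁ + b * d₁') =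
      a ^ 2 * NqR x c₀ c₁ d₀ d₁ + 2 * a * b * NbR x c₀ c₁ d₀ d₁ c₀' c₁' d₀' d₁' +
        b ^ 2 * NqR x c₀' c₁' d₀' d₁' := by
  unfold NqR NbR; ring

/-- For isotropic pairs: `det Y · pv = Nq₁ Nq₂ - Nb²`. [folklore] -/
theorem detY_mul_pv_iso {C D : M2Z} (h : IsIso C D) (x : Fin 6 → ℝ) :
    (x 3 * x 5 - x 4 ^ 2) * pv C D x =
      Nq x (C 0) (D 0) * Nq x (C 1) (D 1) - Nb x (C 0) (D 0) (C 1) (D 1) ^ 2 := by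
  have he : omg (C 0) (D 0) (C 1) (D 1) = 0 := by
    have := congrFun (congrFun h 0) 1
    simp [Matrix.mul_apply, Fin.sum_univ_two] at this
    unfold omg; linarith
  rw [detY_mul_pv, he]; simp

/-- **Positivity**: for a rank-2 symmetric pair and `Z ∈ H₂`, `|det(CZ + D)|² > 0`. [folklore] -/
theorem pv_pos {C D : M2Z} (h : IsPair C D) (hx : x ∈ U) : 0 < pv C D x := by
  have hD := detY_pos hx
  have hid := detY_mul_pv_iso h.iso x
  set n₁ := Nq x (C 0) (D 0) with hn₁
  set n₂ := Nq x (C 1) (D 1) with hn₂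
  set nb := Nb x (C 0) (D 0) (C 1) (D 1) with hnb
  by_contra hle
  push Not at hle
  have hG : n₁ * n₂ - nb ^ 2 ≤ 0 := by
    have : (x 3 * x 5 - x 4 ^ 2) * pv C D x ≤ 0 := by
      unfold detY at hD; nlinarith
    linarith
  -- r₁ ≠ 0
  obtain ⟨j, k, hjk⟩ := h.indep
  have hn₁pos : 0 < n₁ := by
    rcases (NqR_nonneg hx (C 0 0) (C 0 1) (D 0 0) (D 0 1)).lt_or_eq with hlt | heq
    · rw [hn₁, Nq_eq_NqR]; exact_mod_cast hlt
    · exfalso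
      obtain ⟨h1, h2, h3, h4⟩ := NqR_eq_zero hx heq.symm
      apply hjk
      have hrow : ∀ i, rowMat C D 0 i = 0 := by
        rintro (i | i) <;> fin_cases i <;> simp [rowMat] <;> assumption_mod_cast
      simp [minor, hrow]
  -- the real combination `nb • r₁ - n₁ • r₂` has nonpositive `N`-value, hence vanishes
  have hcomb := NqR_lin x nb (-n₁) (C 0 0) (C 0 1) (D 0 0) (D 0 1) (C 1 0) (C 1 1) (D 1 0) (D 1 1)
  rw [← Nq_eq_NqR, ← Nq_eq_NqR, ← Nb_eq_NbR, ← hn₁, ← hn₂, ← hnb] at hcomb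
  have hval : NqR x (nb * C 0 0 + -n₁ * C 1 0) (nb * C 0 1 + -n₁ * C 1 1) (nb * D 0 0 + -n₁ * D 1 0)
      (nb * D 0 1 + -n₁ * D 1 1) = n₁ * (n₁ * n₂ - nb ^ 2) := by rw [hcomb]; ring
  have hnonpos : NqR x (nb * C 0 0 + -n₁ * C 1 0) (nb * C 0 1 + -n₁ * C 1 1)
      (nb * D 0 0 + -n₁ * D 1 0) (nb * D 0 1 + -n₁ * D 1 1) ≤ 0 := by
    rw [hval]; exact mul_nonpos_of_nonneg_of_nonpos hn₁pos.le hG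
  have hzero := le_antisymm hnonpos (NqR_nonneg hx _ _ _ _)
  obtain ⟨e1, e2, e3, e4⟩ := NqR_eq_zero hx hzero
  -- real dependence ⇒ all minors vanish
  apply hjk
  have hrel : ∀ i, nb * (rowMat C D 0 i : ℝ) = n₁ * (rowMat C D 1 i : ℝ) := by
    rintro (i | i) <;> fin_cases i <;> simp [rowMat] <;> linarith
  have key : (n₁ : ℝ) * (minor C D j k : ℝ) = 0 := by
    have hj' := hrel j
    have hk' := hrel k
    simp only [minor, Int.cast_sub, Int.cast_mul]
    calc n₁ * ((rowMat C D 0 j : ℝ) * rowMat C D 1 k - (rowMat C D 0 k : ℝ) * rowMat C D 1 j)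
        = (rowMat C D 0 j : ℝ) * (n₁ * rowMat C D 1 k) - (rowMat C D 0 k : ℝ) * (n₁ * rowMat C D 1 j) := by
          ring
      _ = 0 := by rw [← hj', ← hk']; ring
  have := (mul_eq_zero.1 key).resolve_left hn₁pos.ne'
  exact_mod_cast this

/-! ### Lagrange reduction of positive definite binary forms over `ℤ` -/

section Lagrange

/-- **Lagrange reduction.** A binary form `q(m,n) = A m² + 2B mn + C n²`, positive on `ℤ² ∖ 0`
and with finitely many `(m, n)` below `q(1,0) = A`, admits `U ∈ SL₂(ℤ)` with
`U G Uᵀ = (A' B'; B' C')`, `2|B'| ≤ A' ≤ C'`, `0 < A' ≤ A`. [folklore] -/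
theorem lagrange_reduction (A B C : ℝ)
    (hqpos' : ∀ m n : ℤ, (m, n) ≠ (0, 0) → 0 < A * (m : ℝ) ^ 2 + 2 * B * m * n + C * (n : ℝ) ^ 2)
    (hfin : Set.Finite {p : ℤ × ℤ | p ≠ (0, 0) ∧
      A * (p.1 : ℝ) ^ 2 + 2 * B * p.1 * p.2 + C * (p.2 : ℝ) ^ 2 ≤ A}) :
    ∃ u₁₁ u₁₂ u₂₁ u₂₂ : ℤ, u₁₁ * u₂₂ - u₁₂ * u₂₁ = 1 ∧
      let A' := A * (u₁₁ : ℝ) ^ 2 + 2 * B * u₁₁ * u₁₂ + C * (u₁₂ : ℝ) ^ 2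
      let B' := A * (u₁₁ : ℝ) * u₂₁ + B * ((u₁₁ : ℝ) * u₂₂ + (u₁₂ : ℝ) * u₂₁) + C * (u₁₂ : ℝ) * u₂₂
      let C' := A * (u₂₁ : ℝ) ^ 2 + 2 * B * u₂₁ * u₂₂ + C * (u₂₂ : ℝ) ^ 2
      2 * |B'| ≤ A' ∧ A' ≤ C' ∧ 0 < A' ∧ A' ≤ A := by
  set q : ℤ × ℤ → ℝ := fun p => A * (p.1 : ℝ) ^ 2 + 2 * B * p.1 * p.2 + C * (p.2 : ℝ) ^ 2 with hqdef
  have hqpos : ∀ p : ℤ × ℤ, p ≠ (0, 0) → 0 < q p := fun p hp => hqpos' p.1 p.2 hp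
  have hA : q (1, 0) = A := by simp [hqdef]
  set S : Finset (ℤ × ℤ) := hfin.toFinset with hS
  have hmemS : ∀ p : ℤ × ℤ, p ≠ (0, 0) → q p ≤ A → p ∈ S := by
    intro p hp hle
    rw [hS, Set.Finite.mem_toFinset]
    exact ⟨hp, hle⟩
  have hSne : S.Nonempty := ⟨(1, 0), hmemS _ (by simp) hA.le⟩
  obtain ⟨p₀, hp₀S, hmin⟩ := S.exists_min_image q hSne
  rw [hS, Set.Finite.mem_toFinset] at hp₀S
  obtain ⟨hp₀, hp₀A⟩ := hp₀S
  have hmin' : ∀ p : ℤ × ℤ, p ≠ (0, 0) → q p₀ ≤ q p := by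
    intro p hp
    by_cases hle : q p ≤ A
    · exact hmin p (hmemS p hp hle)
    · push Not at hle
      have : q p₀ ≤ A := hp₀A
      linarith
  obtain ⟨m₀, n₀⟩ := p₀
  -- primitivity of the minimal vector
  have hg : Int.gcd m₀ n₀ = 1 := by
    set g := Int.gcd m₀ n₀ with hgdef
    have hg0 : g ≠ 0 := by
      intro h0
      rw [hgdef, Int.gcd_eq_zero_iff] at h0
      exact hp₀ (by simp [h0.1, h0.2])
    by_contra hg1
    have hg2 : 2 ≤ g := by omega
    obtain ⟨m', hm'⟩ := Int.gcd_dvd_left m₀ n₀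
    obtain ⟨n', hn'⟩ := Int.gcd_dvd_right m₀ n₀
    rw [← hgdef] at hm' hn'
    have hp' : ((m', n') : ℤ × ℤ) ≠ (0, 0) := by
      intro h0
      simp only [Prod.mk.injEq] at h0
      apply hp₀; simp [hm', hn', h0.1, h0.2]
    have h1 := hmin' (m', n') hp'
    have h2 := hqpos (m', n') hp'
    have hq0 : q (m₀, n₀) = (g : ℝ) ^ 2 * q (m', n') := by
      simp only [hqdef, hm', hn']; push_cast; ring
    have hg2' : (2 : ℝ) ≤ g := by exact_mod_cast hg2
    have : (g : ℝ) ^ 2 * q (m', n') ≤ q (m', n') := by rw [← hq0]; exact h1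
    have h4 : (4 : ℝ) * q (m', n') ≤ (g : ℝ) ^ 2 * q (m', n') :=
      mul_le_mul_of_nonneg_right (by nlinarith) h2.le
    linarith
  -- Bezout completion
  obtain ⟨s, t, hst⟩ : ∃ s t : ℤ, m₀ * t - n₀ * s = 1 := by
    refine ⟨-Int.gcdB m₀ n₀, Int.gcdA m₀ n₀, ?_⟩
    have := Int.gcd_eq_gcd_ab m₀ n₀
    rw [hg] at this; push_cast at this; linarith
  -- size reduction
  set A' : ℝ := q (m₀, n₀) with hA'
  have hA'pos : 0 < A' := hqpos _ hp₀
  set B'' : ℝ := A * (m₀ : ℝ) * s + B * ((m₀ : ℝ) * t + (n₀ : ℝ) * s) + C * (n₀ : ℝ) * t with hB''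
  set k : ℤ := round (B'' / A') with hk
  refine ⟨m₀, n₀, s - k * m₀, t - k * n₀, by linear_combination hst, ?_⟩
  simp only
  have hBk : A * (m₀ : ℝ) * ((s - k * m₀ : ℤ) : ℝ) + B * ((m₀ : ℝ) * ((t - k * n₀ : ℤ) : ℝ) +
      (n₀ : ℝ) * ((s - k * m₀ : ℤ) : ℝ)) + C * (n₀ : ℝ) * ((t - k * n₀ : ℤ) : ℝ) = B'' - k * A' := by
    simp only [hB'', hA', hqdef]; push_cast; ring
  have hA'eq : A * (m₀ : ℝ) ^ 2 + 2 * B * m₀ * n₀ + C * (n₀ : ℝ) ^ 2 = A' := by simp [hA', hqdef]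
  rw [hBk, hA'eq]
  refine ⟨?_, ?_, hA'pos, hp₀A⟩
  · have hr := abs_sub_round (B'' / A')
    rw [← hk] at hr
    have : |B'' - k * A'| = |B'' / A' - k| * A' := by
      rw [← abs_of_pos hA'pos, ← abs_mul, abs_of_pos hA'pos]
      congr 1; field_simp
    rw [this]
    nlinarith [abs_nonneg (B'' / A' - k)]
  · have hne : ((s - k * m₀, t - k * n₀) : ℤ × ℤ) ≠ (0, 0) := by
      intro h0
      simp only [Prod.mk.injEq] at h0
      have : m₀ * (t - k * n₀) - n₀ * (s - k * m₀) = 1 := by linear_combination hst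
      rw [h0.1, h0.2] at this; simp at this
    have := hmin' _ hne
    simpa [hqdef] using this

end Lagrange

/-! ### Reduced pairs and the existence of a minimizing pair -/

section Minimizer

variable {x : Fin 6 → ℝ}

/-- Rows of a matrix product. [folklore] -/
theorem row_mul (U C : M2Z) (i : Fin 2) : (U * C) i = U i 0 • C 0 + U i 1 • C 1 := by
  ext j; simp [Matrix.mul_apply, Fin.sum_univ_two]

/-- `N[m r₁ + n r₂] = m² N[r₁] + 2mn N(r₁,r₂) + n² N[r₂]`. [folklore] -/
theorem Nq_comb (x : Fin 6 → ℝ) (C D : M2Z) (m n : ℤ) :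
    Nq x (m • C 0 + n • C 1) (m • D 0 + n • D 1) =
      (m : ℝ) ^ 2 * Nq x (C 0) (D 0) + 2 * m * n * Nb x (C 0) (D 0) (C 1) (D 1) +
        (n : ℝ) ^ 2 * Nq x (C 1) (D 1) := by
  rw [Nq_eq_NqR, Nq_eq_NqR, Nq_eq_NqR, Nb_eq_NbR]
  simp only [Pi.add_apply, Pi.smul_apply, smul_eq_mul, Int.cast_add, Int.cast_mul]
  rw [NqR_lin]

/-- Bilinear expansion of `NbR`. [folklore] -/
theorem NbR_lin (x : Fin 6 → ℝ) (m n m' n' c₀ c₁ d₀ d₁ c₀' c₁' d₀' d₁' : ℝ) :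
    NbR x (m * c₀ + n * c₀') (m * c₁ + n * c₁') (m * d₀ + n * d₀') (m * d₁ + n * d₁')
        (m' * c₀ + n' * c₀') (m' * c₁ + n' * c₁') (m' * d₀ + n' * d₀') (m' * d₁ + n' * d₁') =
      m * m' * NqR x c₀ c₁ d₀ d₁ + (m * n' + n * m') * NbR x c₀ c₁ d₀ d₁ c₀' c₁' d₀' d₁' +
        n * n' * NqR x c₀' c₁' d₀' d₁' := by
  unfold NqR NbR; ring

/-- `N(m r₁ + n r₂, m' r₁ + n' r₂)` expanded. [folklore] -/
theorem Nb_comb (x : Fin 6 → ℝ) (C D : M2Z) (m n m' n' : ℤ) :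
    Nb x (m • C 0 + n • C 1) (m • D 0 + n • D 1) (m' • C 0 + n' • C 1) (m' • D 0 + n' • D 1) =
      (m : ℝ) * m' * Nq x (C 0) (D 0) + ((m : ℝ) * n' + (n : ℝ) * m') * Nb x (C 0) (D 0) (C 1) (D 1) +
        (n : ℝ) * n' * Nq x (C 1) (D 1) := by
  rw [Nq_eq_NqR, Nq_eq_NqR, Nb_eq_NbR, Nb_eq_NbR]
  simp only [Pi.add_apply, Pi.smul_apply, smul_eq_mul, Int.cast_add, Int.cast_mul]
  rw [NbR_lin]

/-- `N`-reduced pairs: `2|N(r₁,r₂)| ≤ N[r₁] ≤ N[r₂]`. [folklore] -/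
def Red (x : Fin 6 → ℝ) (C D : M2Z) : Prop :=
  2 * |Nb x (C 0) (D 0) (C 1) (D 1)| ≤ Nq x (C 0) (D 0) ∧ Nq x (C 0) (D 0) ≤ Nq x (C 1) (D 1)

/-- A dependency `w (C D) = 0` from a vanishing combination of rows. [folklore] -/
theorem vecMul_rowMat_eq_zero {C D : M2Z} {w : Fin 2 → ℤ}
    (hC : w 0 • C 0 + w 1 • C 1 = 0) (hD : w 0 • D 0 + w 1 • D 1 = 0) : w ᵥ* rowMat C D = 0 := by
  ext (j | j)
  · have := congrFun hC j
    simpa [rowMat, Matrix.vecMul, dotProduct, Fin.sum_univ_two] using this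
  · have := congrFun hD j
    simpa [rowMat, Matrix.vecMul, dotProduct, Fin.sum_univ_two] using this

/-- For a rank-2 pair, `N[m r₁ + n r₂] > 0` unless `(m, n) = 0`. [folklore] -/
theorem Nq_comb_pos (hx : x ∈ U) {C D : M2Z} (h : IsPair C D) {m n : ℤ} (hmn : (m, n) ≠ (0, 0)) :
    0 < Nq x (m • C 0 + n • C 1) (m • D 0 + n • D 1) := by
  rw [Nq_eq_NqR]
  rcases (NqR_nonneg hx _ _ _ _).lt_or_eq with hlt | heq
  · exact hlt
  · exfalso
    obtain ⟨e1, e2, e3, e4⟩ := NqR_eq_zero hx heq.symm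
    have hC : m • C 0 + n • C 1 = 0 := by
      ext j; fin_cases j
      · exact_mod_cast e1
      · exact_mod_cast e2
    have hD : m • D 0 + n • D 1 = 0 := by
      ext j; fin_cases j
      · exact_mod_cast e3
      · exact_mod_cast e4
    have hw : (![m, n] : Fin 2 → ℤ) ≠ 0 := by
      intro h0
      apply hmn
      have h1 := congrFun h0 0; have h2 := congrFun h0 1
      simp at h1 h2; simp [h1, h2]
    have hdep := vecMul_rowMat_eq_zero (w := ![m, n]) (by simpa using hC) (by simpa using hD)
    obtain ⟨j, k, hjk⟩ := h.indep
    exact hjk (minors_eq_zero_of_vecMul hw hdep j k)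

/-- Entry bound from an `N`-bound: `det Y κ e² ≤ N[r]` for each entry `e` of `r`. [folklore] -/
theorem entry_sq_le_of_Nq (hx : x ∈ U) (c d : Fin 2 → ℤ) :
    ∀ e ∈ [c 0, c 1, d 0, d 1], detY x * kappa x * (e : ℝ) ^ 2 ≤ Nq x c d := by
  have h := NqR_ge hx (c 0) (c 1) (d 0) (d 1)
  rw [← Nq_eq_NqR] at h
  have hpos : 0 ≤ detY x * kappa x := (mul_pos (detY_pos hx) (kappa_pos hx)).le
  intro e he
  simp only [List.mem_cons, List.not_mem_nil, or_false] at he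
  rcases he with rfl | rfl | rfl | rfl <;>
    nlinarith [mul_nonneg hpos (sq_nonneg (c 0 : ℝ)), mul_nonneg hpos (sq_nonneg (c 1 : ℝ)),
      mul_nonneg hpos (sq_nonneg (d 0 : ℝ)), mul_nonneg hpos (sq_nonneg (d 1 : ℝ))]

/-- Integer vectors with bounded entries form a finite set. [folklore] -/
theorem finite_bounded_vec (R : ℕ) : Set.Finite {c : Fin 2 → ℤ | ∀ j, |c j| ≤ R} := by
  have : {c : Fin 2 → ℤ | ∀ j, |c j| ≤ R} = Set.Icc (fun _ => -(R : ℤ)) (fun _ => (R : ℤ)) := by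
    ext c
    simp only [Set.mem_setOf_eq, Set.mem_Icc, Pi.le_def, abs_le]
    exact ⟨fun h => ⟨fun j => (h j).1, fun j => (h j).2⟩, fun h j => ⟨h.1 j, h.2 j⟩⟩
  rw [this]
  exact Set.finite_Icc _ _

/-- Integer matrices with bounded entries form a finite set. [folklore] -/
theorem finite_bounded_mat (R : ℕ) : Set.Finite {M : M2Z | ∀ i j, |M i j| ≤ R} := by
  have : {M : M2Z | ∀ i j, |M i j| ≤ R} = Set.pi Set.univ (fun _ => {c : Fin 2 → ℤ | ∀ j, |c j| ≤ R}) := by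
    ext M
    exact ⟨fun h i _ => h i, fun h i => h i (Set.mem_univ i)⟩
  rw [this]
  exact Set.Finite.pi fun _ => finite_bounded_vec R

/-- `|e| ≤ ⌈√(B / (det Y κ))⌉` from `det Y κ e² ≤ B`. [folklore] -/
theorem abs_le_ceil_sqrt (hx : x ∈ U) {B : ℝ} {e : ℤ} (h : detY x * kappa x * (e : ℝ) ^ 2 ≤ B) :
    |e| ≤ (⌈Real.sqrt (B / (detY x * kappa x))⌉₊ : ℕ) := by
  have hpos : 0 < detY x * kappa x := mul_pos (detY_pos hx) (kappa_pos hx)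
  have h1 : (e : ℝ) ^ 2 ≤ B / (detY x * kappa x) := by
    rw [le_div_iff₀ hpos]; linarith
  have h2 : |(e : ℝ)| ≤ Real.sqrt (B / (detY x * kappa x)) := by
    rw [← Real.sqrt_sq_eq_abs]; exact Real.sqrt_le_sqrt h1
  have h3 := h2.trans (Nat.le_ceil _)
  have : ((|e| : ℤ) : ℝ) ≤ ((⌈Real.sqrt (B / (detY x * kappa x))⌉₊ : ℕ) : ℤ) := by
    rw [Int.cast_abs]; exact_mod_cast h3
  exact_mod_cast this

/-- **Reduction of pairs**: every rank-2 symmetric pair is `SL₂(ℤ)`-equivalent to an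
`N`-reduced one. [folklore] -/
theorem exists_reduce (hx : x ∈ U) {C D : M2Z} (h : IsPair C D) :
    ∃ V : M2Z, V.det = 1 ∧ Red x (V * C) (V * D) := by
  set A := Nq x (C 0) (D 0)
  set B := Nb x (C 0) (D 0) (C 1) (D 1)
  set Cc := Nq x (C 1) (D 1)
  have hq : ∀ m n : ℤ, A * (m : ℝ) ^ 2 + 2 * B * m * n + Cc * (n : ℝ) ^ 2 =
      Nq x (m • C 0 + n • C 1) (m • D 0 + n • D 1) := by
    intro m n; rw [Nq_comb]; ring
  have hqpos : ∀ m n : ℤ, (m, n) ≠ (0, 0) → 0 < A * (m : ℝ) ^ 2 + 2 * B * m * n + Cc * (n : ℝ) ^ 2 := by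
    intro m n hmn; rw [hq]; exact Nq_comb_pos hx h hmn
  -- finiteness below `A`
  set Rb : ℕ := ⌈Real.sqrt (A / (detY x * kappa x))⌉₊ with hRb
  set F : ℤ × ℤ → (Fin 2 → ℤ) × (Fin 2 → ℤ) := fun p =>
    (p.1 • C 0 + p.2 • C 1, p.1 • D 0 + p.2 • D 1) with hF
  have hinj : Function.Injective F := by
    intro p p' hpp
    simp only [hF, Prod.mk.injEq] at hpp
    obtain ⟨h1, h2⟩ := hpp
    by_contra hne
    have hw : (![p.1 - p'.1, p.2 - p'.2] : Fin 2 → ℤ) ≠ 0 := by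
      intro h0
      have e1 := congrFun h0 0; have e2 := congrFun h0 1
      simp [sub_eq_zero] at e1 e2
      exact hne (Prod.ext e1 e2)
    have hC : (p.1 - p'.1) • C 0 + (p.2 - p'.2) • C 1 = 0 := by
      rw [sub_smul, sub_smul]
      have := h1
      calc p.1 • C 0 - p'.1 • C 0 + (p.2 • C 1 - p'.2 • C 1)
          = (p.1 • C 0 + p.2 • C 1) - (p'.1 • C 0 + p'.2 • C 1) := by abel
        _ = 0 := by rw [h1, sub_self]
    have hD : (p.1 - p'.1) • D 0 + (p.2 - p'.2) • D 1 = 0 := by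
      rw [sub_smul, sub_smul]
      calc p.1 • D 0 - p'.1 • D 0 + (p.2 • D 1 - p'.2 • D 1)
          = (p.1 • D 0 + p.2 • D 1) - (p'.1 • D 0 + p'.2 • D 1) := by abel
        _ = 0 := by rw [h2, sub_self]
    have hdep := vecMul_rowMat_eq_zero (w := ![p.1 - p'.1, p.2 - p'.2]) (by simpa using hC)
      (by simpa using hD)
    obtain ⟨j, k, hjk⟩ := h.indep
    exact hjk (minors_eq_zero_of_vecMul hw hdep j k)
  have hfin : Set.Finite {p : ℤ × ℤ | p ≠ (0, 0) ∧
      A * (p.1 : ℝ) ^ 2 + 2 * B * p.1 * p.2 + Cc * (p.2 : ℝ) ^ 2 ≤ A} := by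
    have hT : Set.Finite ({c : Fin 2 → ℤ | ∀ j, |c j| ≤ Rb} ×ˢ {c : Fin 2 → ℤ | ∀ j, |c j| ≤ Rb}) :=
      (finite_bounded_vec Rb).prod (finite_bounded_vec Rb)
    refine (hT.preimage hinj.injOn).subset ?_
    rintro ⟨m, n⟩ ⟨-, hle⟩
    rw [hq] at hle
    have hb := entry_sq_le_of_Nq hx (m • C 0 + n • C 1) (m • D 0 + n • D 1)
    simp only [Set.mem_preimage, hF, Set.mem_prod, Set.mem_setOf_eq]
    constructor
    · intro j; fin_cases j
      · exact abs_le_ceil_sqrt hx ((hb _ (by simp)).trans hle)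
      · exact abs_le_ceil_sqrt hx ((hb _ (by simp)).trans hle)
    · intro j; fin_cases j
      · exact abs_le_ceil_sqrt hx ((hb _ (by simp)).trans hle)
      · exact abs_le_ceil_sqrt hx ((hb _ (by simp)).trans hle)
  obtain ⟨u₁₁, u₁₂, u₂₁, u₂₂, hdet, hred⟩ := lagrange_reduction A B Cc hqpos hfin
  obtain ⟨h1, h2, -, -⟩ := hred
  refine ⟨!![u₁₁, u₁₂; u₂₁, u₂₂], by rw [Matrix.det_fin_two_of]; linear_combination hdet, ?_⟩
  have e0 : Nq x ((!![u₁₁, u₁₂; u₂₁, u₂₂] * C) 0) ((!![u₁₁, u₁₂; u₂₁, u₂₂] * D) 0) =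
      A * (u₁₁ : ℝ) ^ 2 + 2 * B * u₁₁ * u₁₂ + Cc * (u₁₂ : ℝ) ^ 2 := by
    rw [row_mul, row_mul, hq]; simp
  have e1 : Nq x ((!![u₁₁, u₁₂; u₂₁, u₂₂] * C) 1) ((!![u₁₁, u₁₂; u₂₁, u₂₂] * D) 1) =
      A * (u₂₁ : ℝ) ^ 2 + 2 * B * u₂₁ * u₂₂ + Cc * (u₂₂ : ℝ) ^ 2 := by
    rw [row_mul, row_mul, hq]; simp
  have eb : Nb x ((!![u₁₁, u₁₂; u₂₁, u₂₂] * C) 0) ((!![u₁₁, u₁₂; u₂₁, u₂₂] * D) 0)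
      ((!![u₁₁, u₁₂; u₂₁, u₂₂] * C) 1) ((!![u₁₁, u₁₂; u₂₁, u₂₂] * D) 1) =
      A * (u₁₁ : ℝ) * u₂₁ + B * ((u₁₁ : ℝ) * u₂₂ + (u₁₂ : ℝ) * u₂₁) + Cc * (u₁₂ : ℝ) * u₂₂ := by
    rw [row_mul, row_mul, row_mul, row_mul, Nb_comb]; simp; ring
  exact ⟨by rw [eb, e0]; exact h1, by rw [e0, e1]; exact h2⟩

end Minimizer

section Minimizer2

variable {x : Fin 6 → ℝ}

/-- `(0, 1)` is a pair. [folklore] -/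
theorem isPair_zero_one : IsPair (0 : M2Z) 1 :=
  ⟨by simp [IsIso], ⟨Sum.inr 0, Sum.inr 1, by simp [minor, rowMat]⟩⟩

/-- `|det(0 · Z + 1)|² = 1`. [folklore] -/
theorem pv_zero_one (x : Fin 6 → ℝ) : pv 0 1 x = 1 := by
  simp [pv, pairDet, cZ_zero, cZ_one]

/-- The first row of a rank-2 pair is nonzero, so `N[r₁] ≥ det Y κ`. [folklore] -/
theorem Nq_row0_ge (hx : x ∈ U) {C D : M2Z} (h : IsPair C D) :
    detY x * kappa x ≤ Nq x (C 0) (D 0) := by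
  have hb := entry_sq_le_of_Nq hx (C 0) (D 0)
  have hpos : 0 < detY x * kappa x := mul_pos (detY_pos hx) (kappa_pos hx)
  -- some entry of row 0 is nonzero
  by_cases h0 : C 0 0 = 0 ∧ C 0 1 = 0 ∧ D 0 0 = 0 ∧ D 0 1 = 0
  · exfalso
    obtain ⟨j, k, hjk⟩ := h.indep
    apply hjk
    have hrow : ∀ i, rowMat C D 0 i = 0 := by
      rintro (i | i) <;> fin_cases i <;> simp [rowMat, h0.1, h0.2.1, h0.2.2.1, h0.2.2.2]
    simp [minor, hrow]
  · simp only [not_and_or] at h0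
    have key : ∀ e : ℤ, e ≠ 0 → detY x * kappa x * (e : ℝ) ^ 2 ≤ Nq x (C 0) (D 0) →
        detY x * kappa x ≤ Nq x (C 0) (D 0) := by
      intro e he hle
      have h1 : (1 : ℝ) ≤ (e : ℝ) ^ 2 := by
        have : 1 ≤ |e| := Int.one_le_abs he
        have : (1 : ℝ) ≤ |(e : ℝ)| := by rw [← Int.cast_abs]; exact_mod_cast this
        nlinarith [abs_nonneg (e : ℝ), sq_abs (e : ℝ)]
      nlinarith
    rcases h0 with he | he | he | he
    · exact key _ he (hb _ (by simp))
    · exact key _ he (hb _ (by simp))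
    · exact key _ he (hb _ (by simp))
    · exact key _ he (hb _ (by simp))

/-- The bound `4/(3κ)` for the rows of a reduced pair with `pv ≤ 1`. [folklore] -/
def redBound (x : Fin 6 → ℝ) : ℝ := 4 / (3 * kappa x)

/-- **Reduced pairs with `|det(CZ+D)| ≤ 1` have bounded entries.** [folklore] -/
theorem red_entries_bound (hx : x ∈ U) {C D : M2Z} (h : IsPair C D) (hred : Red x C D)
    (hpv : pv C D x ≤ 1) (i j : Fin 2) :
    |C i j| ≤ (⌈Real.sqrt (redBound x / (detY x * kappa x))⌉₊ : ℕ) ∧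
      |D i j| ≤ (⌈Real.sqrt (redBound x / (detY x * kappa x))⌉₊ : ℕ) := by
  have hD := detY_pos hx
  have hk := kappa_pos hx
  set n₁ := Nq x (C 0) (D 0) with hn₁
  set n₂ := Nq x (C 1) (D 1) with hn₂
  set nb := Nb x (C 0) (D 0) (C 1) (D 1) with hnb
  have hid := detY_mul_pv_iso h.iso x
  rw [← hn₁, ← hn₂, ← hnb] at hid
  obtain ⟨hr1, hr2⟩ := hred
  have hn₁ge : detY x * kappa x ≤ n₁ := Nq_row0_ge hx h
  have hn₁pos : 0 < n₁ := lt_of_lt_of_le (mul_pos hD hk) hn₁ge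
  have hnb2 : nb ^ 2 ≤ n₁ * n₂ / 4 := by
    have h1 : |nb| ≤ n₁ / 2 := by linarith
    have h2 : nb ^ 2 ≤ (n₁ / 2) ^ 2 := by
      rw [← sq_abs]; exact pow_le_pow_left₀ (abs_nonneg _) h1 2
    nlinarith
  have hprod : n₁ * n₂ ≤ (4 / 3) * detY x := by
    have hD' : 0 < x 3 * x 5 - x 4 ^ 2 := by unfold detY at hD; exact hD
    have : (x 3 * x 5 - x 4 ^ 2) * pv C D x ≤ detY x := by
      unfold detY
      have := mul_le_mul_of_nonneg_left hpv hD'.le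
      linarith
    unfold detY at this ⊢
    nlinarith
  have hn₂le : n₂ ≤ redBound x := by
    unfold redBound
    rw [le_div_iff₀ (by positivity)]
    have : detY x * kappa x * n₂ ≤ n₁ * n₂ :=
      mul_le_mul_of_nonneg_right hn₁ge (by linarith)
    nlinarith
  have hn₁le : n₁ ≤ redBound x := hr2.trans hn₂le
  have hb0 := entry_sq_le_of_Nq hx (C 0) (D 0)
  have hb1 := entry_sq_le_of_Nq hx (C 1) (D 1)
  rw [← hn₁] at hb0; rw [← hn₂] at hb1
  fin_cases i <;> fin_cases j
  · exact ⟨abs_le_ceil_sqrt hx ((hb0 _ (by simp)).trans hn₁le),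
      abs_le_ceil_sqrt hx ((hb0 _ (by simp)).trans hn₁le)⟩
  · exact ⟨abs_le_ceil_sqrt hx ((hb0 _ (by simp)).trans hn₁le),
      abs_le_ceil_sqrt hx ((hb0 _ (by simp)).trans hn₁le)⟩
  · exact ⟨abs_le_ceil_sqrt hx ((hb1 _ (by simp)).trans hn₂le),
      abs_le_ceil_sqrt hx ((hb1 _ (by simp)).trans hn₂le)⟩
  · exact ⟨abs_le_ceil_sqrt hx ((hb1 _ (by simp)).trans hn₂le),
      abs_le_ceil_sqrt hx ((hb1 _ (by simp)).trans hn₂le)⟩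

/-- **Existence of a minimizing pair**: some rank-2 symmetric pair `(C*, D*)` minimizes
`|det(CZ + D)|²` over all such pairs, and the minimum is `≤ 1`. [folklore] -/
theorem exists_min_pair (hx : x ∈ U) :
    ∃ C D : M2Z, IsPair C D ∧ pv C D x ≤ 1 ∧ ∀ C' D' : M2Z, IsPair C' D' → pv C D x ≤ pv C' D' x := by
  set Rb : ℕ := ⌈Real.sqrt (redBound x / (detY x * kappa x))⌉₊ with hRb
  set Rset : Set (M2Z × M2Z) := {CD | IsPair CD.1 CD.2 ∧ Red x CD.1 CD.2 ∧ pv CD.1 CD.2 x ≤ 1}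
    with hRset
  have hfin : Rset.Finite := by
    refine ((finite_bounded_mat Rb).prod (finite_bounded_mat Rb)).subset ?_
    rintro ⟨C, D⟩ ⟨hP, hR, hle⟩
    simp only [Set.mem_prod, Set.mem_setOf_eq]
    exact ⟨fun i j => (red_entries_bound hx hP hR hle i j).1,
      fun i j => (red_entries_bound hx hP hR hle i j).2⟩
  -- nonempty: reduce `(0, 1)`
  obtain ⟨V₀, hV₀, hred₀⟩ := exists_reduce hx isPair_zero_one
  have hmem₀ : (V₀ * 0, V₀ * 1) ∈ Rset := by
    refine ⟨isPair_mul_left (by rw [hV₀]; exact one_ne_zero) isPair_zero_one, hred₀, ?_⟩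
    simp only
    rw [pv_mul_left, pv_zero_one, hV₀]; simp
  set S := hfin.toFinset with hS
  have hSne : S.Nonempty := ⟨_, by rw [hS, Set.Finite.mem_toFinset]; exact hmem₀⟩
  obtain ⟨⟨C, D⟩, hCDS, hmin⟩ := S.exists_min_image (fun CD => pv CD.1 CD.2 x) hSne
  rw [hS, Set.Finite.mem_toFinset] at hCDS
  obtain ⟨hP, -, hle⟩ := hCDS
  refine ⟨C, D, hP, hle, fun C' D' hP' => ?_⟩
  by_cases hle' : pv C' D' x ≤ 1
  · obtain ⟨V, hV, hred⟩ := exists_reduce hx hP'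
    have hmem : (V * C', V * D') ∈ Rset := by
      refine ⟨isPair_mul_left (by rw [hV]; exact one_ne_zero) hP', hred, ?_⟩
      simp only; rw [pv_mul_left, hV]; simpa using hle'
    have := hmin (V * C', V * D') (by rw [hS, Set.Finite.mem_toFinset]; exact hmem)
    simp only at this
    rw [pv_mul_left, hV] at this; simpa using this
  · push Not at hle'; linarith

end Minimizer2

/-! ### Symplectic completion of a minimizing pair -/

section Completion

variable {x : Fin 6 → ℝ}

/-- The symplectic pairing of row vectors: `ω(u, v) = u_c · v_d - u_d · v_c`. [folklore] -/
def omg' (u v : Fin 2 ⊕ Fin 2 → ℤ) : ℤ :=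
  u (Sum.inl 0) * v (Sum.inr 0) + u (Sum.inl 1) * v (Sum.inr 1) -
    u (Sum.inr 0) * v (Sum.inl 0) - u (Sum.inr 1) * v (Sum.inl 1)

/-- `ω` is alternating. [folklore] -/
theorem omg'_self (u : Fin 2 ⊕ Fin 2 → ℤ) : omg' u u = 0 := by unfold omg'; ring
/-- `ω` is antisymmetric. [folklore] -/
theorem omg'_anti (u v : Fin 2 ⊕ Fin 2 → ℤ) : omg' v u = -omg' u v := by unfold omg'; ring
/-- `ω` is additive on the left. [folklore] -/
theorem omg'_add_left (u u' v : Fin 2 ⊕ Fin 2 → ℤ) : omg' (u + u') v = omg' u v + omg' u' v := by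
  unfold omg'; simp; ring
/-- `ω` is homogeneous on the left. [folklore] -/
theorem omg'_smul_left (t : ℤ) (u v : Fin 2 ⊕ Fin 2 → ℤ) : omg' (t • u) v = t * omg' u v := by
  unfold omg'; simp; ring
/-- `ω` is subtractive on the left. [folklore] -/
theorem omg'_sub_left (u u' v : Fin 2 ⊕ Fin 2 → ℤ) : omg' (u - u') v = omg' u v - omg' u' v := by
  unfold omg'; simp; ring
/-- `ω` is additive on the right. [folklore] -/
theorem omg'_add_right (u v v' : Fin 2 ⊕ Fin 2 → ℤ) : omg' u (v + v') = omg' u v + omg' u v' := by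
  unfold omg'; simp; ring
/-- `ω` is homogeneous on the right. [folklore] -/
theorem omg'_smul_right (t : ℤ) (u v : Fin 2 ⊕ Fin 2 → ℤ) : omg' u (t • v) = t * omg' u v := by
  unfold omg'; simp; ring
/-- `ω` is subtractive on the right. [folklore] -/
theorem omg'_sub_right (u v v' : Fin 2 ⊕ Fin 2 → ℤ) : omg' u (v - v') = omg' u v - omg' u v' := by
  unfold omg'; simp; ring

/-- The rows of `(C D)` pair to `0` iff the pair is isotropic. [folklore] -/
theorem omg'_rows {C D : M2Z} (h : IsIso C D) : omg' (rowMat C D 0) (rowMat C D 1) = 0 := by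
  have := congrFun (congrFun h 0) 1
  simp [Matrix.mul_apply, Fin.sum_univ_two] at this
  simp [omg', rowMat]; linarith

/-- `(M J Mᵀ)_{ab} = -ω(M_a, M_b)`. [folklore] -/
theorem mul_J_mul_transpose_apply (M : Matrix (Fin 2 ⊕ Fin 2) (Fin 2 ⊕ Fin 2) ℤ) (a b : Fin 2 ⊕ Fin 2) :
    (M * Matrix.J (Fin 2) ℤ * Mᵀ) a b = -omg' (M a) (M b) := by
  simp [Matrix.J, Matrix.mul_apply, Fintype.sum_sum_type, Fin.sum_univ_two, Matrix.fromBlocks,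
    omg', Matrix.one_apply]
  ring

/-- The `4 × 4` matrix with rows `s₁, s₂, r₁, r₂`. [folklore] -/
def ofRows (s₁ s₂ r₁ r₂ : Fin 2 ⊕ Fin 2 → ℤ) : Matrix (Fin 2 ⊕ Fin 2) (Fin 2 ⊕ Fin 2) ℤ :=
  Matrix.of (Sum.elim ![s₁, s₂] ![r₁, r₂])

/-- Row `1` of `ofRows`. [folklore] -/
@[simp] theorem ofRows_inl0 (s₁ s₂ r₁ r₂ : Fin 2 ⊕ Fin 2 → ℤ) : ofRows s₁ s₂ r₁ r₂ (Sum.inl 0) = s₁ := rfl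
/-- Row `2` of `ofRows`. [folklore] -/
@[simp] theorem ofRows_inl1 (s₁ s₂ r₁ r₂ : Fin 2 ⊕ Fin 2 → ℤ) : ofRows s₁ s₂ r₁ r₂ (Sum.inl 1) = s₂ := rfl
/-- Row `3` of `ofRows`. [folklore] -/
@[simp] theorem ofRows_inr0 (s₁ s₂ r₁ r₂ : Fin 2 ⊕ Fin 2 → ℤ) : ofRows s₁ s₂ r₁ r₂ (Sum.inr 0) = r₁ := rfl
/-- Row `4` of `ofRows`. [folklore] -/
@[simp] theorem ofRows_inr1 (s₁ s₂ r₁ r₂ : Fin 2 ⊕ Fin 2 → ℤ) : ofRows s₁ s₂ r₁ r₂ (Sum.inr 1) = r₂ := rfl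

/-- **Symplectic matrices from rows**: rows `(s₁, s₂, r₁, r₂)` with `ω(s₁,s₂) = ω(r₁,r₂) = 0`,
`ω(s_i, r_j) = δ_ij` form an element of `Sp₄(ℤ)`. [folklore] -/
theorem ofRows_mem {s₁ s₂ r₁ r₂ : Fin 2 ⊕ Fin 2 → ℤ} (hss : omg' s₁ s₂ = 0) (hrr : omg' r₁ r₂ = 0)
    (h11 : omg' s₁ r₁ = 1) (h12 : omg' s₁ r₂ = 0) (h21 : omg' s₂ r₁ = 0) (h22 : omg' s₂ r₂ = 1) :
    ofRows s₁ s₂ r₁ r₂ ∈ Matrix.symplecticGroup (Fin 2) ℤ := by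
  rw [SymplecticGroup.mem_iff]
  ext a b
  rw [mul_J_mul_transpose_apply]
  have h11' := omg'_anti s₁ r₁; have h12' := omg'_anti s₁ r₂
  have h21' := omg'_anti s₂ r₁; have h22' := omg'_anti s₂ r₂
  have hss' := omg'_anti s₁ s₂; have hrr' := omg'_anti r₁ r₂
  rcases a with a | a <;> rcases b with b | b <;> fin_cases a <;> fin_cases b <;>
    simp [Matrix.J, Matrix.fromBlocks, omg'_self, hss, hrr, h11, h12, h21, h22, h11', h12', h21',
      h22', hss', hrr']

/-- **Bezout for rows**: a row with coprime entries (`vgcd = 1`) pairs to `1` with some integral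
vector. [folklore] -/
theorem exists_omg'_eq_one {r : Fin 2 ⊕ Fin 2 → ℤ} (h : vgcd r = 1) : ∃ s, omg' s r = 1 := by
  -- r = (c₀, c₁, d₀, d₁); ω(s, r) = s_c₀ d₀ + s_c₁ d₁ - s_d₀ c₀ - s_d₁ c₁
  set c₀ := r (Sum.inl 0); set c₁ := r (Sum.inl 1); set d₀ := r (Sum.inr 0); set d₁ := r (Sum.inr 1)
  have h1 := Int.gcd_eq_gcd_ab c₀ d₀
  have h2 := Int.gcd_eq_gcd_ab c₁ d₁
  have h3 := Int.gcd_eq_gcd_ab (Int.gcd c₀ d₀ : ℤ) (Int.gcd c₁ d₁ : ℤ)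
  have h3' : ((Int.gcd (Int.gcd c₀ d₀ : ℤ) (Int.gcd c₁ d₁ : ℤ) : ℕ) : ℤ) = 1 := by
    unfold vgcd at h; exact_mod_cast h
  set α := Int.gcdA (Int.gcd c₀ d₀ : ℤ) (Int.gcd c₁ d₁ : ℤ)
  set β := Int.gcdB (Int.gcd c₀ d₀ : ℤ) (Int.gcd c₁ d₁ : ℤ)
  set x₁ := Int.gcdA c₀ d₀; set y₁ := Int.gcdB c₀ d₀
  set x₂ := Int.gcdA c₁ d₁; set y₂ := Int.gcdB c₁ d₁
  -- 1 = (c₀ x₁ + d₀ y₁) α + (c₁ x₂ + d₁ y₂) β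
  refine ⟨Sum.elim ![y₁ * α, y₂ * β] ![-(x₁ * α), -(x₂ * β)], ?_⟩
  simp only [omg', Sum.elim_inl, Sum.elim_inr, Matrix.cons_val_zero, Matrix.cons_val_one]
  have key : (1 : ℤ) = (c₀ * x₁ + d₀ * y₁) * α + (c₁ * x₂ + d₁ * y₂) * β := by
    rw [← h1, ← h2, ← h3', h3]
  linear_combination -key

/-- Divisibility of all entries gives a factorisation of the row. [folklore] -/
theorem row_eq_smul_of_dvd {r : Fin 2 ⊕ Fin 2 → ℤ} {g : ℤ} (h : ∀ i, g ∣ r i) :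
    ∃ r' : Fin 2 ⊕ Fin 2 → ℤ, r = g • r' := by
  choose f hf using h
  exact ⟨f, funext fun i => by rw [Pi.smul_apply, smul_eq_mul]; exact hf i⟩

/-- Matrices from their two rows. [folklore] -/
theorem eq_of_rows (C : M2Z) : C = Matrix.of ![C 0, C 1] := by
  ext i j; fin_cases i <;> rfl

/-- **Primitivity of the first row of a minimizing pair.** [folklore] -/
theorem vgcd_row0_eq_one (hx : x ∈ U) {C D : M2Z} (hP : IsPair C D)
    (hmin : ∀ C' D' : M2Z, IsPair C' D' → pv C D x ≤ pv C' D' x) : vgcd (rowMat C D 0) = 1 := by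
  set g := vgcd (rowMat C D 0) with hg
  have hg0 : g ≠ 0 := by
    intro h0
    rw [hg, vgcd_eq_zero_iff] at h0
    obtain ⟨j, k, hjk⟩ := hP.indep
    apply hjk
    simp [minor, h0]
  by_contra hg1
  have hg2 : (2 : ℤ) ≤ g := by omega
  obtain ⟨r', hr'⟩ := row_eq_smul_of_dvd (vgcd_dvd (rowMat C D 0))
  rw [← hg] at hr'
  -- the smaller pair: rows (r', row 1)
  set C' : M2Z := Matrix.of ![fun j => r' (Sum.inl j), C 1] with hC'
  set D' : M2Z := Matrix.of ![fun j => r' (Sum.inr j), D 1] with hD'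
  set V : M2Z := !![(g : ℤ), 0; 0, 1] with hV
  have hVdet : V.det = g := by simp [hV, Matrix.det_fin_two_of]
  have hCeq : C = V * C' := by
    ext i j; fin_cases i
    · have := congrFun hr' (Sum.inl j)
      simp [rowMat] at this
      simp [hV, hC', Matrix.mul_apply, Fin.sum_univ_two, this]
    · simp [hV, hC', Matrix.mul_apply, Fin.sum_univ_two]
  have hDeq : D = V * D' := by
    ext i j; fin_cases i
    · have := congrFun hr' (Sum.inr j)
      simp [rowMat] at this
      simp [hV, hD', Matrix.mul_apply, Fin.sum_univ_two, this]
    · simp [hV, hD', Matrix.mul_apply, Fin.sum_univ_two]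
  have hVne : V.det ≠ 0 := by rw [hVdet]; exact_mod_cast hg0
  have hP' : IsPair C' D' := isPair_of_mul_left hVne (by rw [← hCeq, ← hDeq]; exact hP)
  have hle := hmin C' D' hP'
  have hpos := pv_pos hP' hx
  rw [hCeq, hDeq, pv_mul_left, hVdet] at hle
  have hg2' : (2 : ℝ) ≤ (g : ℤ) := by exact_mod_cast hg2
  have : (4 : ℝ) * pv C' D' x ≤ ((g : ℤ) : ℝ) ^ 2 * pv C' D' x :=
    mul_le_mul_of_nonneg_right (by nlinarith) hpos.le
  linarith

/-- Swapping the roles of the rows: `(C, D) ↦ (swap C, swap D)` by the matrix `!![0,1;1,0]`. [folklore] -/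
theorem vgcd_row1_eq_one (hx : x ∈ U) {C D : M2Z} (hP : IsPair C D)
    (hmin : ∀ C' D' : M2Z, IsPair C' D' → pv C D x ≤ pv C' D' x) : vgcd (rowMat C D 1) = 1 := by
  set W : M2Z := !![0, 1; 1, 0] with hW
  have hWdet : W.det = -1 := by simp [hW, Matrix.det_fin_two_of]
  have hP' : IsPair (W * C) (W * D) := isPair_mul_left (by rw [hWdet]; norm_num) hP
  have hmin' : ∀ C' D' : M2Z, IsPair C' D' → pv (W * C) (W * D) x ≤ pv C' D' x := by
    intro C' D' h'; rw [pv_mul_left, hWdet]; simpa using hmin C' D' h'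
  have h := vgcd_row0_eq_one hx hP' hmin'
  have hrow : rowMat (W * C) (W * D) 0 = rowMat C D 1 := by
    ext (j | j) <;> simp [rowMat, hW, Matrix.vecMul, dotProduct, Fin.sum_univ_two]
  rwa [hrow] at h

/-- **Symplectic completion of a minimizing pair**: some `γ ∈ Sp₄(ℤ)` has bottom rows `(C D)`
forming a pair that minimizes `|det(CZ + D)|²` over all rank-2 symmetric integral pairs. [folklore] -/
theorem exists_sp4Z_min (hx : x ∈ U) :
    ∃ γ : Sp4Z, pv (zC γ) (zD γ) x ≤ 1 ∧
      ∀ C' D' : M2Z, IsPair C' D' → pv (zC γ) (zD γ) x ≤ pv C' D' x := by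
  obtain ⟨C, D, hP, hle, hmin⟩ := exists_min_pair hx
  -- Step A: a vector pairing to 1 with the first row
  obtain ⟨s, hs⟩ := exists_omg'_eq_one (vgcd_row0_eq_one hx hP hmin)
  -- Step B: replace the second row by `r₂ - ω(s, r₂) r₁`
  set t : ℤ := omg' s (rowMat C D 1) with ht
  set V : M2Z := !![1, 0; -t, 1] with hV
  have hVdet : V.det = 1 := by simp [hV, Matrix.det_fin_two_of]
  set C₂ : M2Z := V * C with hC₂
  set D₂ : M2Z := V * D with hD₂
  have hP₂ : IsPair C₂ D₂ := isPair_mul_left (by rw [hVdet]; exact one_ne_zero) hP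
  have hpv₂ : pv C₂ D₂ x = pv C D x := by rw [hC₂, hD₂, pv_mul_left, hVdet]; simp
  have hmin₂ : ∀ C' D' : M2Z, IsPair C' D' → pv C₂ D₂ x ≤ pv C' D' x := by
    intro C' D' h'; rw [hpv₂]; exact hmin C' D' h'
  have hrow0 : rowMat C₂ D₂ 0 = rowMat C D 0 := by
    ext (j | j) <;> simp [rowMat, hC₂, hD₂, hV, Matrix.vecMul, dotProduct, Fin.sum_univ_two]
  have hrow1 : rowMat C₂ D₂ 1 = rowMat C D 1 - t • rowMat C D 0 := by
    ext (j | j) <;> simp [rowMat, hC₂, hD₂, hV, Matrix.vecMul, dotProduct, Fin.sum_univ_two] <;> ring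
  obtain ⟨r₁, hr₁⟩ : ∃ r₁, r₁ = rowMat C₂ D₂ 0 := ⟨_, rfl⟩
  obtain ⟨r₂, hr₂⟩ : ∃ r₂, r₂ = rowMat C₂ D₂ 1 := ⟨_, rfl⟩
  have hs1 : omg' s r₁ = 1 := by rw [hr₁, hrow0]; exact hs
  have hs2 : omg' s r₂ = 0 := by
    rw [hr₂, hrow1, omg'_sub_right, omg'_smul_right, hs, ← ht]; ring
  have hrr : omg' r₁ r₂ = 0 := by rw [hr₁, hr₂]; exact omg'_rows hP₂.iso
  -- Step C: a vector in `K = {ω(·, r₁) = 0}` pairing to 1 with `r₂`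
  have hprim : vgcd r₂ = 1 := by rw [hr₂]; exact vgcd_row1_eq_one hx hP₂ hmin₂
  obtain ⟨s₀, hs₀⟩ := exists_omg'_eq_one hprim
  obtain ⟨s₂, hs₂def⟩ : ∃ s₂, s₂ = s₀ - (omg' s₀ r₁) • s := ⟨_, rfl⟩
  have h21 : omg' s₂ r₁ = 0 := by
    rw [hs₂def, omg'_sub_left, omg'_smul_left, hs1]; ring
  have h22 : omg' s₂ r₂ = 1 := by
    rw [hs₂def, omg'_sub_left, omg'_smul_left, hs2, mul_zero, sub_zero]; exact hs₀
  -- Step D: isotropy correction of `s`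
  obtain ⟨s₁, hs₁def⟩ : ∃ s₁, s₁ = s + (omg' s s₂) • r₂ := ⟨_, rfl⟩
  have h11 : omg' s₁ r₁ = 1 := by
    rw [hs₁def, omg'_add_left, omg'_smul_left, hs1, omg'_anti r₁ r₂, hrr]; ring
  have h12 : omg' s₁ r₂ = 0 := by
    rw [hs₁def, omg'_add_left, omg'_smul_left, hs2, omg'_self]; ring
  have hss : omg' s₁ s₂ = 0 := by
    rw [hs₁def, omg'_add_left, omg'_smul_left, omg'_anti s₂ r₂, h22]; ring
  let γ : Sp4Z := ⟨ofRows s₁ s₂ r₁ r₂, ofRows_mem hss hrr h11 h12 h21 h22⟩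
  have hzC : zC γ = C₂ := by
    ext i j
    fin_cases i
    · show r₁ (Sum.inl j) = C₂ 0 j; rw [hr₁]; rfl
    · show r₂ (Sum.inl j) = C₂ 1 j; rw [hr₂]; rfl
  have hzD : zD γ = D₂ := by
    ext i j
    fin_cases i
    · show r₁ (Sum.inr j) = D₂ 0 j; rw [hr₁]; rfl
    · show r₂ (Sum.inr j) = D₂ 1 j; rw [hr₂]; rfl
  refine ⟨γ, ?_, ?_⟩
  · rw [hzC, hzD, hpv₂]; exact hle
  · intro C' D' h'; rw [hzC, hzD]; exact hmin₂ C' D' h'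

end Completion

/-! ### Maximal height: a point of the orbit where all pairs have `|det(CZ+D)| ≥ 1` -/

section MaxHeight

variable {x : Fin 6 → ℝ}

/-- **Existence of a point of maximal height in every orbit**: for every `p ∈ H₂` there is
`γ ∈ Sp₄(ℤ)` such that `|det(C γ⟨Z⟩ + D)| ≥ 1` for all rank-2 symmetric integral pairs. [folklore] -/
theorem exists_smul_pv_ge_one (p : U) :
    ∃ γ : Sp4Z, ∀ C D : M2Z, IsPair C D → 1 ≤ pv C D (γ • p : U).1 := by
  obtain ⟨γ, -, hmin⟩ := exists_sp4Z_min p.2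
  refine ⟨γ, fun C D hP => ?_⟩
  have hpos := pv_pos (isPair_bottom γ) p.2
  rw [coe_sp4Z_smul, pv_smul γ C D p.2, le_div_iff₀ hpos, one_mul]
  exact hmin _ _ (isPair_smul_pair γ hP)

/-- Elements with `C = 0` have `|det D| = 1`, hence preserve the property "all pairs `≥ 1`". [folklore] -/
theorem pv_bottom_eq_one_of_zC {δ : Sp4Z} (hδ : zC δ = 0) (x : Fin 6 → ℝ) : pv (zC δ) (zD δ) x = 1 := by
  obtain ⟨-, -, r3⟩ := row_rel δ
  rw [hδ] at r3
  simp only [Matrix.transpose_zero, Matrix.mul_zero, sub_zero] at r3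
  have hdet : (zA δ).det * (zD δ).det = 1 := by
    have := congrArg Matrix.det r3
    rwa [Matrix.det_mul, Matrix.det_transpose, Matrix.det_one] at this
  have hD : (zD δ).det = 1 ∨ (zD δ).det = -1 :=
    Int.isUnit_iff.1 (IsUnit.of_mul_eq_one_right _ hdet)
  rw [hδ, pv, pairDet, cZ_zero, Matrix.zero_mul, zero_add]
  unfold cZ
  rw [← RingHom.map_det]
  rcases hD with h | h <;> simp [h]

/-- Elements with `C = 0` preserve the property "all pairs `≥ 1`". [folklore] -/
theorem pv_ge_one_smul {δ : Sp4Z} (hδ : zC δ = 0) {p : U}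
    (h : ∀ C D : M2Z, IsPair C D → 1 ≤ pv C D p.1) :
    ∀ C D : M2Z, IsPair C D → 1 ≤ pv C D (δ • p : U).1 := by
  intro C D hP
  rw [coe_sp4Z_smul, pv_smul δ C D p.2, pv_bottom_eq_one_of_zC hδ, div_one]
  exact h _ _ (isPair_smul_pair δ hP)

/-! #### The parabolic elements: `u(U)`, the reflection, translations -/

/-- `u(V) = (V 0; 0 V⁻ᵀ)` for `V ∈ SL₂(ℤ)`. [folklore] -/
def uMatZ (V : M2Z) : Matrix (Fin 2 ⊕ Fin 2) (Fin 2 ⊕ Fin 2) ℤ :=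
  fromBlocks V 0 0 (V.adjugate)ᵀ

/-- `u(V) ∈ Sp₄(ℤ)`. [cite: Klingen1990, Ch. I §3 Prop. 6] -/
theorem uMatZ_mem {V : M2Z} (hV : V.det = 1) : uMatZ V ∈ Matrix.symplecticGroup (Fin 2) ℤ := by
  rw [uMatZ, SymplecticGroup.fromBlocks_mem_iff]
  refine ⟨by simp, by simp, ?_⟩
  simp only [Matrix.transpose_zero, Matrix.zero_mul, sub_zero]
  rw [← Matrix.transpose_mul, Matrix.adjugate_mul, hV, one_smul, Matrix.transpose_one]

/-- The element `u(V) ∈ Sp₄(ℤ)`. [folklore] -/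
def uEl {V : M2Z} (hV : V.det = 1) : Sp4Z := ⟨uMatZ V, uMatZ_mem hV⟩

/-- `u(V)` has `C = 0`. [folklore] -/
theorem zC_uEl {V : M2Z} (hV : V.det = 1) : zC (uEl hV) = 0 := by
  simp [zC, uEl, uMatZ]

/-- `u(V)` has `A = V`. [folklore] -/
theorem zA_uEl {V : M2Z} (hV : V.det = 1) : zA (uEl hV) = V := by simp [zA, uEl, uMatZ]
/-- `u(V)` has `B = 0`. [folklore] -/
theorem zB_uEl {V : M2Z} (hV : V.det = 1) : zB (uEl hV) = 0 := by simp [zB, uEl, uMatZ]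
/-- `u(V)` has `D = V⁻ᵀ`. [folklore] -/
theorem zD_uEl {V : M2Z} (hV : V.det = 1) : zD (uEl hV) = (V.adjugate)ᵀ := by simp [zD, uEl, uMatZ]

/-- **`u(V)` acts by `Z ↦ V Z Vᵀ`.** [folklore] -/
theorem toZ_smul_uEl {V : M2Z} (hV : V.det = 1) (p : U) :
    toZ (uEl hV • p : U).1 = cZ V * toZ p.1 * (cZ V)ᵀ := by
  have hx := p.2
  rw [coe_sp4Z_smul, toZ_smulVec _ hx, smulZ, matP_toR, matQ_toR, zA_uEl, zB_uEl, zC_uEl, zD_uEl,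
    cZ_zero, Matrix.zero_mul, zero_add, add_zero]
  congr 1
  -- (cZ (adj V)ᵀ)⁻¹ = (cZ V)ᵀ
  have hinv : cZ (V.adjugate)ᵀ * (cZ V)ᵀ = 1 := by
    have : cZ (V.adjugate)ᵀ = (cZ V.adjugate)ᵀ := by
      ext i j; simp [cZ]
    rw [this, ← Matrix.transpose_mul, ← cZ_mul, Matrix.mul_adjugate, hV, one_smul, cZ_one,
      Matrix.transpose_one]
  exact Matrix.inv_eq_right_inv hinv

/-- The reflection `E = diag(1,-1,1,-1)`. [folklore] -/
def reflMat : Matrix (Fin 2 ⊕ Fin 2) (Fin 2 ⊕ Fin 2) ℤ :=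
  fromBlocks !![1, 0; 0, -1] 0 0 !![1, 0; 0, -1]

/-- The reflection is symplectic. [folklore] -/
theorem reflMat_mem : reflMat ∈ Matrix.symplecticGroup (Fin 2) ℤ := by
  rw [reflMat, SymplecticGroup.fromBlocks_mem_iff]
  refine ⟨by simp, by simp, ?_⟩
  ext i j; fin_cases i <;> fin_cases j <;> simp [Matrix.mul_apply, Fin.sum_univ_two]

/-- The reflection as an element of `Sp₄(ℤ)`. [folklore] -/
def reflEl : Sp4Z := ⟨reflMat, reflMat_mem⟩

/-- The reflection has `C = 0`. [folklore] -/
theorem zC_reflEl : zC reflEl = 0 := by simp [zC, reflEl, reflMat]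

/-- **The reflection in coordinates**: `(x₀, -x₁, x₂, x₃, -x₄, x₅)`. [folklore] -/
theorem coe_smul_reflEl (p : U) : (reflEl • p : U).1 = ![p.1 0, -p.1 1, p.1 2, p.1 3, -p.1 4, p.1 5] := by
  have hx := p.2
  have hZ : toZ (reflEl • p : U).1 = cZ !![1, 0; 0, -1] * toZ p.1 * cZ !![1, 0; 0, -1] := by
    rw [coe_sp4Z_smul, toZ_smulVec _ hx, smulZ, matP_toR, matQ_toR]
    have hA : zA reflEl = !![1, 0; 0, -1] := by simp [zA, reflEl, reflMat]
    have hB : zB reflEl = 0 := by simp [zB, reflEl, reflMat]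
    have hD : zD reflEl = !![1, 0; 0, -1] := by simp [zD, reflEl, reflMat]
    rw [hA, hB, zC_reflEl, hD, cZ_zero, Matrix.zero_mul, zero_add, add_zero]
    congr 1
    apply Matrix.inv_eq_right_inv
    ext i j; fin_cases i <;> fin_cases j <;> simp [Matrix.mul_apply, Fin.sum_univ_two]
  have key : (reflEl • p : U).1 = ofZ (toZ (reflEl • p : U).1) := (ofZ_toZ _).symm
  rw [key, hZ]
  ext i
  fin_cases i <;>
    simp [ofZ, Literature.NumberTheory.ModularForms.Sp4Covolume.toZ, Matrix.mul_apply, Fin.sum_univ_two]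

/-- Translations `t(S) = (1 S; 0 1)`, `S` symmetric integral. [folklore] -/
def transMat (s₀ s₁ s₂ : ℤ) : Matrix (Fin 2 ⊕ Fin 2) (Fin 2 ⊕ Fin 2) ℤ :=
  fromBlocks 1 !![s₀, s₁; s₁, s₂] 0 1

/-- Translations are symplectic. [cite: Klingen1990, Ch. I §3 Prop. 6] -/
theorem transMat_mem (s₀ s₁ s₂ : ℤ) : transMat s₀ s₁ s₂ ∈ Matrix.symplecticGroup (Fin 2) ℤ := by
  rw [transMat, SymplecticGroup.fromBlocks_mem_iff]
  refine ⟨by simp, ?_, by simp⟩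
  ext i j; fin_cases i <;> fin_cases j <;> simp [Matrix.mul_apply, Fin.sum_univ_two]

/-- Translations as elements of `Sp₄(ℤ)`. [folklore] -/
def transEl (s₀ s₁ s₂ : ℤ) : Sp4Z := ⟨transMat s₀ s₁ s₂, transMat_mem s₀ s₁ s₂⟩

/-- Translations have `C = 0`. [folklore] -/
theorem zC_transEl (s₀ s₁ s₂ : ℤ) : zC (transEl s₀ s₁ s₂) = 0 := by simp [zC, transEl, transMat]

/-- **Translations in coordinates**: `X ↦ X + S`, `Y` fixed. [folklore] -/
theorem coe_smul_transEl (s₀ s₁ s₂ : ℤ) (p : U) :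
    (transEl s₀ s₁ s₂ • p : U).1 = ![p.1 0 + s₀, p.1 1 + s₁, p.1 2 + s₂, p.1 3, p.1 4, p.1 5] := by
  have hx := p.2
  have hZ : toZ (transEl s₀ s₁ s₂ • p : U).1 = toZ p.1 + cZ !![s₀, s₁; s₁, s₂] := by
    rw [coe_sp4Z_smul, toZ_smulVec _ hx, smulZ, matP_toR, matQ_toR]
    have hA : zA (transEl s₀ s₁ s₂) = 1 := by simp [zA, transEl, transMat]
    have hB : zB (transEl s₀ s₁ s₂) = !![s₀, s₁; s₁, s₂] := by simp [zB, transEl, transMat]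
    have hD : zD (transEl s₀ s₁ s₂) = 1 := by simp [zD, transEl, transMat]
    rw [hA, hB, zC_transEl, hD, cZ_zero, cZ_one, Matrix.zero_mul, zero_add, Matrix.one_mul, inv_one,
      Matrix.mul_one]
  have key : (transEl s₀ s₁ s₂ • p : U).1 = ofZ (toZ (transEl s₀ s₁ s₂ • p : U).1) := (ofZ_toZ _).symm
  rw [key, hZ]
  ext i
  fin_cases i <;> simp [ofZ, Literature.NumberTheory.ModularForms.Sp4Covolume.toZ]

end MaxHeight

/-! ### Reduction of `Y` and `X`; every orbit meets `F₂` -/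

section Covers

variable {x : Fin 6 → ℝ}

/-- The `Y`-coordinates of `u(V) • p`: `Y ↦ V Y Vᵀ`. [folklore] -/
theorem coe_smul_uEl {V : M2Z} (hV : V.det = 1) (p : U) :
    (uEl hV • p : U).1 3 = p.1 3 * (V 0 0 : ℝ) ^ 2 + 2 * p.1 4 * (V 0 0) * (V 0 1) + p.1 5 * (V 0 1 : ℝ) ^ 2 ∧
    (uEl hV • p : U).1 4 = p.1 3 * (V 0 0 : ℝ) * (V 1 0) +
      p.1 4 * ((V 0 0 : ℝ) * (V 1 1) + (V 0 1 : ℝ) * (V 1 0)) + p.1 5 * (V 0 1 : ℝ) * (V 1 1) ∧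
    (uEl hV • p : U).1 5 = p.1 3 * (V 1 0 : ℝ) ^ 2 + 2 * p.1 4 * (V 1 0) * (V 1 1) + p.1 5 * (V 1 1 : ℝ) ^ 2 := by
  have key : (uEl hV • p : U).1 = ofZ (toZ (uEl hV • p : U).1) := (ofZ_toZ _).symm
  rw [key, toZ_smul_uEl]
  refine ⟨?_, ?_, ?_⟩ <;>
    simp [ofZ, Literature.NumberTheory.ModularForms.Sp4Covolume.toZ, Matrix.mul_apply,
      Fin.sum_univ_two] <;> ring

/-- **Lagrange reduction of `Y` inside the orbit**: some `u(V)` makes `2|y₁₂| ≤ y₁₁ ≤ y₂₂`. [folklore] -/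
theorem exists_uEl_reduce (p : U) :
    ∃ V : M2Z, ∃ hV : V.det = 1, 2 * |(uEl hV • p : U).1 4| ≤ (uEl hV • p : U).1 3 ∧
      (uEl hV • p : U).1 3 ≤ (uEl hV • p : U).1 5 := by
  obtain ⟨h3, hdet⟩ := p.2
  have hD : 0 < p.1 3 * p.1 5 - p.1 4 ^ 2 := by linarith
  have h5 : 0 < p.1 5 := x5_pos p.2
  set A := p.1 3; set B := p.1 4; set Cc := p.1 5
  have hx3q : ∀ m n : ℤ, A * (A * (m : ℝ) ^ 2 + 2 * B * m * n + Cc * (n : ℝ) ^ 2) =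
      (A * m + B * n) ^ 2 + (A * Cc - B ^ 2) * (n : ℝ) ^ 2 := by intro m n; ring
  have hx5q : ∀ m n : ℤ, Cc * (A * (m : ℝ) ^ 2 + 2 * B * m * n + Cc * (n : ℝ) ^ 2) =
      (Cc * n + B * m) ^ 2 + (A * Cc - B ^ 2) * (m : ℝ) ^ 2 := by intro m n; ring
  have hqpos : ∀ m n : ℤ, (m, n) ≠ (0, 0) → 0 < A * (m : ℝ) ^ 2 + 2 * B * m * n + Cc * (n : ℝ) ^ 2 := by
    intro m n hmn
    by_contra hle; push Not at hle
    have h1 : A * (A * (m : ℝ) ^ 2 + 2 * B * m * n + Cc * (n : ℝ) ^ 2) ≤ 0 :=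
      mul_nonpos_of_nonneg_of_nonpos h3.le hle
    rw [hx3q] at h1
    have hDn : (A * Cc - B ^ 2) * (n : ℝ) ^ 2 ≤ 0 := by nlinarith [sq_nonneg (A * m + B * n)]
    have hn2 : (n : ℝ) ^ 2 ≤ 0 := by
      by_contra hc; push Not at hc
      have := mul_pos hD hc; linarith
    have hn : (n : ℝ) = 0 := pow_eq_zero_iff (n := 2) (by norm_num) |>.1
      (le_antisymm hn2 (sq_nonneg _))
    have hm' : (A * m + B * n) ^ 2 ≤ 0 := by nlinarith [sq_nonneg (n : ℝ), mul_nonneg hD.le (sq_nonneg (n:ℝ))]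
    have hm'' : A * m + B * n = 0 := by nlinarith [sq_nonneg (A * m + B * n)]
    rw [hn, mul_zero, add_zero] at hm''
    have hm : (m : ℝ) = 0 := (mul_eq_zero.1 hm'').resolve_left h3.ne'
    exact hmn (by simp [Int.cast_eq_zero.1 hm, Int.cast_eq_zero.1 hn])
  -- finiteness below `A`
  set R : ℕ := ⌈Real.sqrt (max (Cc * A) (A * A) / (A * Cc - B ^ 2))⌉₊ with hR
  have hfin : Set.Finite {q : ℤ × ℤ | q ≠ (0, 0) ∧
      A * (q.1 : ℝ) ^ 2 + 2 * B * q.1 * q.2 + Cc * (q.2 : ℝ) ^ 2 ≤ A} := by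
    refine (Set.Finite.prod (Set.finite_Icc (-(R : ℤ)) R) (Set.finite_Icc (-(R : ℤ)) R)).subset ?_
    rintro ⟨m, n⟩ ⟨-, hle⟩
    simp only at hle
    have hm2 : (A * Cc - B ^ 2) * (m : ℝ) ^ 2 ≤ Cc * A := by
      have := mul_le_mul_of_nonneg_left hle h5.le
      rw [hx5q] at this; nlinarith [sq_nonneg (Cc * n + B * m)]
    have hn2 : (A * Cc - B ^ 2) * (n : ℝ) ^ 2 ≤ A * A := by
      have := mul_le_mul_of_nonneg_left hle h3.le
      rw [hx3q] at this; nlinarith [sq_nonneg (A * m + B * n)]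
    have hbd : ∀ e : ℤ, (A * Cc - B ^ 2) * (e : ℝ) ^ 2 ≤ max (Cc * A) (A * A) → |e| ≤ (R : ℤ) := by
      intro e he
      have h1 : (e : ℝ) ^ 2 ≤ max (Cc * A) (A * A) / (A * Cc - B ^ 2) := by
        rw [le_div_iff₀ hD]; linarith
      have h2 : |(e : ℝ)| ≤ Real.sqrt (max (Cc * A) (A * A) / (A * Cc - B ^ 2)) := by
        rw [← Real.sqrt_sq_eq_abs]; exact Real.sqrt_le_sqrt h1
      have h3 := h2.trans (Nat.le_ceil _)
      rw [← hR] at h3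
      have : ((|e| : ℤ) : ℝ) ≤ ((R : ℕ) : ℤ) := by rw [Int.cast_abs]; exact_mod_cast h3
      exact_mod_cast this
    have hm := abs_le.1 (hbd m (hm2.trans (le_max_left _ _)))
    have hn := abs_le.1 (hbd n (hn2.trans (le_max_right _ _)))
    simp only [Set.mem_prod, Set.mem_Icc]
    exact ⟨⟨hm.1, hm.2⟩, ⟨hn.1, hn.2⟩⟩
  obtain ⟨u₁₁, u₁₂, u₂₁, u₂₂, hdet1, hred⟩ := lagrange_reduction A B Cc hqpos hfin
  obtain ⟨h1, h2, -, -⟩ := hred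
  refine ⟨!![u₁₁, u₁₂; u₂₁, u₂₂], by rw [Matrix.det_fin_two_of]; linear_combination hdet1, ?_⟩
  obtain ⟨e3, e4, e5⟩ := coe_smul_uEl (V := !![u₁₁, u₁₂; u₂₁, u₂₂])
    (by rw [Matrix.det_fin_two_of]; linear_combination hdet1) p
  have eA : (uEl (V := !![u₁₁, u₁₂; u₂₁, u₂₂]) (by rw [Matrix.det_fin_two_of]; linear_combination hdet1) • p : U).1 3 =
      A * (u₁₁ : ℝ) ^ 2 + 2 * B * u₁₁ * u₁₂ + Cc * (u₁₂ : ℝ) ^ 2 := by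
    rw [e3]; simp; ring
  have eB : (uEl (V := !![u₁₁, u₁₂; u₂₁, u₂₂]) (by rw [Matrix.det_fin_two_of]; linear_combination hdet1) • p : U).1 4 =
      A * (u₁₁ : ℝ) * u₂₁ + B * ((u₁₁ : ℝ) * u₂₂ + (u₁₂ : ℝ) * u₂₁) + Cc * (u₁₂ : ℝ) * u₂₂ := by
    rw [e4]; simp; ring
  have eC : (uEl (V := !![u₁₁, u₁₂; u₂₁, u₂₂]) (by rw [Matrix.det_fin_two_of]; linear_combination hdet1) • p : U).1 5 =
      A * (u₂₁ : ℝ) ^ 2 + 2 * B * u₂₁ * u₂₂ + Cc * (u₂₂ : ℝ) ^ 2 := by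
    rw [e5]; simp; ring
  rw [eA, eB, eC]
  exact ⟨h1, h2⟩

/-- The matrices of an integral pair given by eight integers. [folklore] -/
theorem isPair_of_clause (c₁ c₂ c₃ c₄ d₁ d₂ d₃ d₄ : ℤ) (hrel : c₁ * d₃ + c₂ * d₄ = c₃ * d₁ + c₄ * d₂)
    (hmin : c₁ * c₄ - c₂ * c₃ ≠ 0 ∨ c₁ * d₃ - d₁ * c₃ ≠ 0 ∨ c₁ * d₄ - d₂ * c₃ ≠ 0 ∨
      c₂ * d₃ - d₁ * c₄ ≠ 0 ∨ c₂ * d₄ - d₂ * c₄ ≠ 0 ∨ d₁ * d₄ - d₂ * d₃ ≠ 0) :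
    IsPair !![c₁, c₂; c₃, c₄] !![d₁, d₂; d₃, d₄] := by
  constructor
  · unfold IsIso
    ext i j; fin_cases i <;> fin_cases j <;> simp [Matrix.mul_apply, Fin.sum_univ_two] <;> linarith
  · rcases hmin with h | h | h | h | h | h
    · exact ⟨Sum.inl 0, Sum.inl 1, by simpa [minor, rowMat] using h⟩
    · exact ⟨Sum.inl 0, Sum.inr 0, by simpa [minor, rowMat] using h⟩
    · exact ⟨Sum.inl 0, Sum.inr 1, by simpa [minor, rowMat] using h⟩
    · exact ⟨Sum.inl 1, Sum.inr 0, by simpa [minor, rowMat] using h⟩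
    · exact ⟨Sum.inl 1, Sum.inr 1, by simpa [minor, rowMat] using h⟩
    · exact ⟨Sum.inr 0, Sum.inr 1, by simpa [minor, rowMat] using h⟩

/-- `det(CZ + D)` written out. [folklore] -/
theorem pairDet_explicit (c₁ c₂ c₃ c₄ d₁ d₂ d₃ d₄ : ℤ) (x : Fin 6 → ℝ) :
    pairDet !![c₁, c₂; c₃, c₄] !![d₁, d₂; d₃, d₄] x =
      ((c₁ : ℂ) * ((x 0 : ℂ) + (x 3 : ℂ) * Complex.I) + (c₂ : ℂ) * ((x 1 : ℂ) + (x 4 : ℂ) * Complex.I) +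
        (d₁ : ℂ)) * ((c₃ : ℂ) * ((x 1 : ℂ) + (x 4 : ℂ) * Complex.I) + (c₄ : ℂ) * ((x 2 : ℂ) + (x 5 : ℂ) *
        Complex.I) + (d₄ : ℂ)) - ((c₁ : ℂ) * ((x 1 : ℂ) + (x 4 : ℂ) * Complex.I) + (c₂ : ℂ) * ((x 2 : ℂ) +
        (x 5 : ℂ) * Complex.I) + (d₂ : ℂ)) * ((c₃ : ℂ) * ((x 0 : ℂ) + (x 3 : ℂ) * Complex.I) + (c₄ : ℂ) *
        ((x 1 : ℂ) + (x 4 : ℂ) * Complex.I) + (d₃ : ℂ)) := by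
  simp [pairDet, Matrix.det_fin_two, Matrix.mul_apply, Fin.sum_univ_two,
    Literature.NumberTheory.ModularForms.Sp4Covolume.toZ]

/-- **Condition (i) of `F₂` from "all pairs `≥ 1`".** [folklore] -/
theorem clause_of_pv_ge_one (h : ∀ C D : M2Z, IsPair C D → 1 ≤ pv C D x) :
    ∀ (c₁ c₂ c₃ c₄ d₁ d₂ d₃ d₄ : ℤ), c₁ * d₃ + c₂ * d₄ = c₃ * d₁ + c₄ * d₂ →
    (c₁ * c₄ - c₂ * c₃ ≠ 0 ∨ c₁ * d₃ - d₁ * c₃ ≠ 0 ∨ c₁ * d₄ - d₂ * c₃ ≠ 0 ∨ c₂ * d₃ - d₁ * c₄ ≠ 0 ∨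
      c₂ * d₄ - d₂ * c₄ ≠ 0 ∨ d₁ * d₄ - d₂ * d₃ ≠ 0) →
    1 ≤ ‖((c₁ : ℂ) * ((x 0 : ℂ) + (x 3 : ℂ) * Complex.I) + (c₂ : ℂ) * ((x 1 : ℂ) + (x 4 : ℂ) * Complex.I) +
        (d₁ : ℂ)) * ((c₃ : ℂ) * ((x 1 : ℂ) + (x 4 : ℂ) * Complex.I) + (c₄ : ℂ) * ((x 2 : ℂ) + (x 5 : ℂ) *
        Complex.I) + (d₄ : ℂ)) - ((c₁ : ℂ) * ((x 1 : ℂ) + (x 4 : ℂ) * Complex.I) + (c₂ : ℂ) * ((x 2 : ℂ) +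
        (x 5 : ℂ) * Complex.I) + (d₂ : ℂ)) * ((c₃ : ℂ) * ((x 0 : ℂ) + (x 3 : ℂ) * Complex.I) + (c₄ : ℂ) *
        ((x 1 : ℂ) + (x 4 : ℂ) * Complex.I) + (d₃ : ℂ))‖ := by
  intro c₁ c₂ c₃ c₄ d₁ d₂ d₃ d₄ hrel hmin
  have h1 := h _ _ (isPair_of_clause c₁ c₂ c₃ c₄ d₁ d₂ d₃ d₄ hrel hmin)
  rw [pv, pairDet_explicit, Complex.normSq_eq_norm_sq] at h1
  nlinarith [norm_nonneg (((c₁ : ℂ) * ((x 0 : ℂ) + (x 3 : ℂ) * Complex.I) + (c₂ : ℂ) * ((x 1 : ℂ) + (x 4 : ℂ) * Complex.I) +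
        (d₁ : ℂ)) * ((c₃ : ℂ) * ((x 1 : ℂ) + (x 4 : ℂ) * Complex.I) + (c₄ : ℂ) * ((x 2 : ℂ) + (x 5 : ℂ) *
        Complex.I) + (d₄ : ℂ)) - ((c₁ : ℂ) * ((x 1 : ℂ) + (x 4 : ℂ) * Complex.I) + (c₂ : ℂ) * ((x 2 : ℂ) +
        (x 5 : ℂ) * Complex.I) + (d₂ : ℂ)) * ((c₃ : ℂ) * ((x 0 : ℂ) + (x 3 : ℂ) * Complex.I) + (c₄ : ℂ) *
        ((x 1 : ℂ) + (x 4 : ℂ) * Complex.I) + (d₃ : ℂ)))]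

/-- **Covering: every `Sp₄(ℤ)`-orbit in `H₂` meets Siegel's fundamental domain `F₂`.**
(Klingen I.3 Thm. 1 / Gottschling: maximal height, then Minkowski reduction of `Y`, then
reduction of `X` modulo 1.) [folklore] -/
theorem covers_F2 (p : U) : ∃ γ : Sp4Z, (γ • p : U).1 ∈ siegelFundamentalDomainTwo := by
  -- (1) maximal height
  obtain ⟨γ₁, h₁⟩ := exists_smul_pv_ge_one p
  set p₁ : U := γ₁ • p with hp₁
  -- (2) reduce Y
  obtain ⟨V, hV, hr1, hr2⟩ := exists_uEl_reduce p₁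
  set p₂ : U := uEl hV • p₁ with hp₂
  have h₂ : ∀ C D : M2Z, IsPair C D → 1 ≤ pv C D p₂.1 := pv_ge_one_smul (zC_uEl hV) h₁
  -- (3) sign of y₁₂
  obtain ⟨δ, p₃, hp₃, h₃, hy0, hy1, hy2⟩ : ∃ δ : Sp4Z, ∃ p₃ : U, p₃ = δ • p₂ ∧
      (∀ C D : M2Z, IsPair C D → 1 ≤ pv C D p₃.1) ∧ 0 ≤ p₃.1 4 ∧ 2 * p₃.1 4 ≤ p₃.1 3 ∧ p₃.1 3 ≤ p₃.1 5 := by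
    by_cases hs : 0 ≤ p₂.1 4
    · refine ⟨1, p₂, (one_smul _ _).symm, h₂, hs, ?_, hr2⟩
      rw [abs_of_nonneg hs] at hr1; exact hr1
    · push Not at hs
      refine ⟨reflEl, reflEl • p₂, rfl, pv_ge_one_smul zC_reflEl h₂, ?_, ?_, ?_⟩
      · rw [coe_smul_reflEl]; simp; linarith
      · rw [coe_smul_reflEl]; simp; rw [abs_of_neg hs] at hr1; linarith
      · rw [coe_smul_reflEl]; simpa using hr2
  -- (4) reduce X
  set p₄ : U := transEl (-round (p₃.1 0)) (-round (p₃.1 1)) (-round (p₃.1 2)) • p₃ with hp₄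
  have h₄ : ∀ C D : M2Z, IsPair C D → 1 ≤ pv C D p₄.1 := pv_ge_one_smul (zC_transEl _ _ _) h₃
  have hc := coe_smul_transEl (-round (p₃.1 0)) (-round (p₃.1 1)) (-round (p₃.1 2)) p₃
  refine ⟨transEl (-round (p₃.1 0)) (-round (p₃.1 1)) (-round (p₃.1 2)) * δ * uEl hV * γ₁, ?_⟩
  have : (transEl (-round (p₃.1 0)) (-round (p₃.1 1)) (-round (p₃.1 2)) * δ * uEl hV * γ₁) • p = p₄ := by
    rw [hp₄, hp₃, hp₂, hp₁]; simp only [mul_smul]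
  rw [this]
  have hU4 := p₄.2
  refine ⟨hU4.1, hU4.2, ?_, ?_, ?_, ?_, ?_, ?_, clause_of_pv_ge_one h₄⟩
  · rw [hp₄, hc]
    show |p₃.1 0 + ((-round (p₃.1 0) : ℤ) : ℝ)| ≤ 1 / 2
    push_cast; rw [← sub_eq_add_neg]; exact abs_sub_round _
  · rw [hp₄, hc]
    show |p₃.1 1 + ((-round (p₃.1 1) : ℤ) : ℝ)| ≤ 1 / 2
    push_cast; rw [← sub_eq_add_neg]; exact abs_sub_round _
  · rw [hp₄, hc]
    show |p₃.1 2 + ((-round (p₃.1 2) : ℤ) : ℝ)| ≤ 1 / 2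
    push_cast; rw [← sub_eq_add_neg]; exact abs_sub_round _
  · rw [hp₄, hc]; exact hy0
  · rw [hp₄, hc]; exact hy1
  · rw [hp₄, hc]; exact hy2

end Covers

/-! ### Stage 4b: null sets for the uniqueness statement -/

section NullAnalytic

open MeasureTheory Set

/-- **Affine hyperplanes are Lebesgue-null**: `{x | L x = c}` for a nonzero linear functional `L`. [folklore] -/
theorem volume_linear_eq_const_null (L : (Fin 6 → ℝ) →ₗ[ℝ] ℝ) (hL : L ≠ 0) (c : ℝ) :
    volume {x : Fin 6 → ℝ | L x = c} = 0 := by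
  by_cases hne : ∃ x₀, L x₀ = c
  · obtain ⟨x₀, hx₀⟩ := hne
    have hset : {x : Fin 6 → ℝ | L x = c} = (fun h => (-x₀) + h) ⁻¹' (LinearMap.ker L : Set (Fin 6 → ℝ)) := by
      ext x
      simp only [Set.mem_setOf_eq, Set.mem_preimage, SetLike.mem_coe, LinearMap.mem_ker, map_add,
        map_neg, hx₀]
      constructor
      · intro h; rw [h]; ring
      · intro h; linarith
    rw [hset, measure_preimage_add]
    apply Measure.addHaar_submodule
    intro htop
    apply hL
    apply LinearMap.ext
    intro v
    have hv : v ∈ LinearMap.ker L := by rw [htop]; exact Submodule.mem_top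
    simpa using hv
  · have : {x : Fin 6 → ℝ | L x = c} = ∅ := by
      ext x; simp only [Set.mem_setOf_eq, Set.mem_empty_iff_false, iff_false]
      exact fun h => hne ⟨x, h⟩
    rw [this, measure_empty]

/-- The coordinate hyperplane `{x | x i = c}` is null. [folklore] -/
theorem volume_coord_eq_null (i : Fin 6) (c : ℝ) : volume {x : Fin 6 → ℝ | x i = c} = 0 := by
  have h := volume_linear_eq_const_null (LinearMap.proj i) ?_ c
  · simpa using h
  · intro h0
    have := congrArg (fun L : (Fin 6 → ℝ) →ₗ[ℝ] ℝ => L (Pi.single i 1)) h0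
    simp at this

/-- `{x | x i = a * x j}` is null for `i ≠ j`. [folklore] -/
theorem volume_coord_eq_mul_null {i j : Fin 6} (hij : i ≠ j) (a : ℝ) :
    volume {x : Fin 6 → ℝ | x i = a * x j} = 0 := by
  have h := volume_linear_eq_const_null (LinearMap.proj i - a • LinearMap.proj j) ?_ 0
  · convert h using 2
    ext x; simp [sub_eq_zero]
  · intro h0
    have := congrArg (fun L : (Fin 6 → ℝ) →ₗ[ℝ] ℝ => L (Pi.single i 1)) h0
    simp [hij.symm] at this

/-- `insertNth` is an update of a fixed base point. [folklore] -/
theorem insertNth_eq_update (i : Fin 6) (t : ℝ) (y : Fin 5 → ℝ) :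
    (Fin.insertNth i t y : Fin 6 → ℝ) = Function.update (Fin.insertNth i (0 : ℝ) y) i t := by
  ext j
  by_cases h : j = i
  · subst h; simp [Fin.insertNth_apply_same]
  · obtain ⟨k, rfl⟩ := Fin.exists_succAbove_eq h
    rw [Function.update_of_ne h, Fin.insertNth_apply_succAbove, Fin.insertNth_apply_succAbove]

/-- **A measurable set all of whose sections along one coordinate are finite is null.** [folklore] -/
theorem volume_null_of_finite_sections (i : Fin 6) {T : Set (Fin 6 → ℝ)} (hT : MeasurableSet T)
    (hfin : ∀ y : Fin 5 → ℝ, Set.Finite {t : ℝ | (Fin.insertNth i t y : Fin 6 → ℝ) ∈ T}) :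
    volume T = 0 := by
  have e := (volume_preserving_piFinSuccAbove (fun _ : Fin 6 => ℝ) i).symm
  rw [← e.measure_preimage_equiv T, Measure.volume_eq_prod,
    Measure.prod_apply_symm ((MeasurableEquiv.measurable _) hT)]
  have h0 : ∀ y : Fin 5 → ℝ, volume ((fun t : ℝ => (t, y)) ⁻¹'
      ((MeasurableEquiv.piFinSuccAbove (fun _ : Fin 6 => ℝ) i).symm ⁻¹' T)) = 0 := by
    intro y
    have hset : ((fun t : ℝ => (t, y)) ⁻¹'
        ((MeasurableEquiv.piFinSuccAbove (fun _ : Fin 6 => ℝ) i).symm ⁻¹' T)) =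
        {t : ℝ | (Fin.insertNth i t y : Fin 6 → ℝ) ∈ T} := Set.ext fun t => Iff.rfl
    rw [hset]
    exact (hfin y).measure_zero volume
  exact (lintegral_congr h0).trans lintegral_zero

/-- The root set of a genuine real quadratic is finite. [folklore] -/
theorem finite_quadratic_roots {a b c : ℝ} (ha : a ≠ 0) : Set.Finite {t : ℝ | a * t ^ 2 + b * t + c = 0} := by
  classical
  set P : Polynomial ℝ := Polynomial.C a * Polynomial.X ^ 2 + Polynomial.C b * Polynomial.X + Polynomial.C c
    with hPdef
  have hP : P ≠ 0 := by
    intro h0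
    have := congrArg (fun Q : Polynomial ℝ => Q.coeff 2) h0
    simp [hPdef, Polynomial.coeff_X_pow] at this
    exact ha this
  refine (P.roots.toFinset.finite_toSet).subset ?_
  intro t ht
  simp only [Set.mem_setOf_eq] at ht
  rw [Finset.mem_coe, Multiset.mem_toFinset, Polynomial.mem_roots hP, Polynomial.IsRoot.def]
  simp only [hPdef, Polynomial.eval_add, Polynomial.eval_mul, Polynomial.eval_C, Polynomial.eval_pow,
    Polynomial.eval_X]
  linarith

/-- `{t ∈ ℝ | |a t + b|² = 1}` is finite for `a ≠ 0`. [folklore] -/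
theorem finite_normSq_affine_eq_one {a b : ℂ} (ha : a ≠ 0) :
    Set.Finite {t : ℝ | Complex.normSq (a * t + b) = 1} := by
  have hna : Complex.normSq a ≠ 0 := by rwa [Ne, Complex.normSq_eq_zero]
  refine (finite_quadratic_roots (b := 2 * (a.re * b.re + a.im * b.im)) (c := Complex.normSq b - 1) hna).subset ?_
  intro t ht
  simp only [Set.mem_setOf_eq] at ht ⊢
  rw [Complex.normSq_apply] at ht
  simp only [Complex.add_re, Complex.mul_re, Complex.ofReal_re, Complex.ofReal_im, mul_zero, sub_zero,
    Complex.add_im, Complex.mul_im, zero_add] at ht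
  rw [Complex.normSq_apply, Complex.normSq_apply]
  nlinarith [ht]

variable {C D : M2Z}

/-- Measurability of `x ↦ det(CZ + D)`. [folklore] -/
theorem measurable_pairDet (C D : M2Z) : Measurable (pairDet C D) := by
  have : pairDet C D = fun x => pairDet !![C 0 0, C 0 1; C 1 0, C 1 1] !![D 0 0, D 0 1; D 1 0, D 1 1] x := by
    congr 1 <;> exact (Matrix.etaExpand_eq _).symm
  rw [this]
  simp only [pairDet_explicit]
  apply Continuous.measurable
  fun_prop

/-- Measurability of `|det(CZ+D)|²`. [folklore] -/
theorem measurable_pv (C D : M2Z) : Measurable (pv C D) :=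
  Complex.continuous_normSq.measurable.comp (measurable_pairDet C D)

/-- **The slice lemma**: if `det(CZ+D) = α(x) x_i + β(x)` with `α, β` independent of `x_i` and
measurable `α`, then `{|det(CZ+D)|² = 1} ∩ {α ≠ 0}` is null. [folklore] -/
theorem slice_null (i : Fin 6) (α β : (Fin 6 → ℝ) → ℂ) (hαm : Measurable α)
    (hα : ∀ x t, α (Function.update x i t) = α x) (hβ : ∀ x t, β (Function.update x i t) = β x)
    (hdec : ∀ x, pairDet C D x = α x * (x i : ℂ) + β x) :
    volume ({x : Fin 6 → ℝ | pv C D x = 1} ∩ {x | α x ≠ 0}) = 0 := by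
  apply volume_null_of_finite_sections i
  · exact ((measurable_pv C D) (measurableSet_singleton 1)).inter
      ((hαm (measurableSet_singleton 0)).compl)
  · intro y
    set x₀ : Fin 6 → ℝ := Fin.insertNth i (0 : ℝ) y with hx₀
    by_cases h0 : α x₀ = 0
    · convert Set.finite_empty
      ext t
      simp only [Set.mem_setOf_eq, Set.mem_inter_iff, Set.mem_empty_iff_false, iff_false, not_and,
        not_not]
      intro _
      rw [insertNth_eq_update, ← hx₀, hα]; exact h0
    · refine (finite_normSq_affine_eq_one (b := β x₀) h0).subset ?_
      intro t ht
      simp only [Set.mem_setOf_eq, Set.mem_inter_iff] at ht ⊢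
      obtain ⟨h1, -⟩ := ht
      rw [insertNth_eq_update, ← hx₀] at h1
      rw [pv, hdec, hα, hβ, Function.update_self] at h1
      exact h1

/-! #### The affine decompositions of `det(CZ + D)` -/

/-- In `z₁₁ = x₀ + i x₃`: coefficient `α₀ = det C · z₂₂ + (c₁d₄ - c₃d₂)`. [folklore] -/
def alpha0 (C D : M2Z) (x : Fin 6 → ℝ) : ℂ :=
  ((C 0 0 * C 1 1 - C 0 1 * C 1 0 : ℤ) : ℂ) * ((x 2 : ℂ) + (x 5 : ℂ) * Complex.I) +
    ((C 0 0 * D 1 1 - C 1 0 * D 0 1 : ℤ) : ℂ)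

/-- The remainder in the `x₀`-decomposition. [folklore] -/
def beta0 (C D : M2Z) (x : Fin 6 → ℝ) : ℂ :=
  alpha0 C D x * ((x 3 : ℂ) * Complex.I) +
    (((C 0 1 : ℂ) * ((x 1 : ℂ) + (x 4 : ℂ) * Complex.I) + (D 0 0 : ℂ)) *
      ((C 1 0 : ℂ) * ((x 1 : ℂ) + (x 4 : ℂ) * Complex.I) + (C 1 1 : ℂ) * ((x 2 : ℂ) + (x 5 : ℂ) * Complex.I) + (D 1 1 : ℂ)) -
     ((C 0 0 : ℂ) * ((x 1 : ℂ) + (x 4 : ℂ) * Complex.I) + (C 0 1 : ℂ) * ((x 2 : ℂ) + (x 5 : ℂ) * Complex.I) + (D 0 1 : ℂ)) *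
      ((C 1 1 : ℂ) * ((x 1 : ℂ) + (x 4 : ℂ) * Complex.I) + (D 1 0 : ℂ)))

/-- `det(CZ+D) = α₀ x₀ + β₀`. [folklore] -/
theorem pairDet_dec0 (C D : M2Z) (x : Fin 6 → ℝ) :
    pairDet C D x = alpha0 C D x * (x 0 : ℂ) + beta0 C D x := by
  have : pairDet C D x = pairDet !![C 0 0, C 0 1; C 1 0, C 1 1] !![D 0 0, D 0 1; D 1 0, D 1 1] x := by
    congr 1 <;> exact (Matrix.etaExpand_eq _).symm
  rw [this, pairDet_explicit]
  simp only [alpha0, beta0]; push_cast; ring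

/-- In `z₂₂ = x₂ + i x₅`: coefficient `α₂ = det C · z₁₁ + (c₄d₁ - c₂d₃)`. [folklore] -/
def alpha2 (C D : M2Z) (x : Fin 6 → ℝ) : ℂ :=
  ((C 0 0 * C 1 1 - C 0 1 * C 1 0 : ℤ) : ℂ) * ((x 0 : ℂ) + (x 3 : ℂ) * Complex.I) +
    ((C 1 1 * D 0 0 - C 0 1 * D 1 0 : ℤ) : ℂ)

/-- The remainder in the `x₂`-decomposition. [folklore] -/
def beta2 (C D : M2Z) (x : Fin 6 → ℝ) : ℂ :=
  alpha2 C D x * ((x 5 : ℂ) * Complex.I) +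
    (((C 0 0 : ℂ) * ((x 0 : ℂ) + (x 3 : ℂ) * Complex.I) + (C 0 1 : ℂ) * ((x 1 : ℂ) + (x 4 : ℂ) * Complex.I) + (D 0 0 : ℂ)) *
      ((C 1 0 : ℂ) * ((x 1 : ℂ) + (x 4 : ℂ) * Complex.I) + (D 1 1 : ℂ)) -
     ((C 0 0 : ℂ) * ((x 1 : ℂ) + (x 4 : ℂ) * Complex.I) + (D 0 1 : ℂ)) *
      ((C 1 0 : ℂ) * ((x 0 : ℂ) + (x 3 : ℂ) * Complex.I) + (C 1 1 : ℂ) * ((x 1 : ℂ) + (x 4 : ℂ) * Complex.I) + (D 1 0 : ℂ)))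

/-- `det(CZ+D) = α₂ x₂ + β₂`. [folklore] -/
theorem pairDet_dec2 (C D : M2Z) (x : Fin 6 → ℝ) :
    pairDet C D x = alpha2 C D x * (x 2 : ℂ) + beta2 C D x := by
  have : pairDet C D x = pairDet !![C 0 0, C 0 1; C 1 0, C 1 1] !![D 0 0, D 0 1; D 1 0, D 1 1] x := by
    congr 1 <;> exact (Matrix.etaExpand_eq _).symm
  rw [this, pairDet_explicit]
  simp only [alpha2, beta2]; push_cast; ring

/-- In `z₁₂ = x₁ + i x₄` (when `det C = 0`): constant coefficient
`α₁ = c₃d₁ - c₁d₃ + c₂d₄ - c₄d₂`. [folklore] -/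
def alpha1 (C D : M2Z) : ℂ :=
  ((C 1 0 * D 0 0 - C 0 0 * D 1 0 + C 0 1 * D 1 1 - C 1 1 * D 0 1 : ℤ) : ℂ)

/-- The remainder in the `x₁`-decomposition (valid when `det C = 0`). [folklore] -/
def beta1 (C D : M2Z) (x : Fin 6 → ℝ) : ℂ :=
  alpha1 C D * ((x 4 : ℂ) * Complex.I) +
    (((C 0 0 : ℂ) * ((x 0 : ℂ) + (x 3 : ℂ) * Complex.I) + (D 0 0 : ℂ)) *
      ((C 1 1 : ℂ) * ((x 2 : ℂ) + (x 5 : ℂ) * Complex.I) + (D 1 1 : ℂ)) -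
     ((C 0 1 : ℂ) * ((x 2 : ℂ) + (x 5 : ℂ) * Complex.I) + (D 0 1 : ℂ)) *
      ((C 1 0 : ℂ) * ((x 0 : ℂ) + (x 3 : ℂ) * Complex.I) + (D 1 0 : ℂ)))

/-- `det(CZ+D) = α₁ x₁ + β₁` when `det C = 0`. [folklore] -/
theorem pairDet_dec1 (C D : M2Z) (hdet : C 0 0 * C 1 1 - C 0 1 * C 1 0 = 0) (x : Fin 6 → ℝ) :
    pairDet C D x = alpha1 C D * (x 1 : ℂ) + beta1 C D x := by
  have : pairDet C D x = pairDet !![C 0 0, C 0 1; C 1 0, C 1 1] !![D 0 0, D 0 1; D 1 0, D 1 1] x := by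
    congr 1 <;> exact (Matrix.etaExpand_eq _).symm
  rw [this, pairDet_explicit]
  have hdet' : (C 0 0 : ℂ) * C 1 1 - C 0 1 * C 1 0 = 0 := by exact_mod_cast hdet
  simp only [alpha1, beta1]; push_cast
  linear_combination (((x 1 : ℂ) + (x 4 : ℂ) * Complex.I) ^ 2 * 0 - ((x 1 : ℂ) + (x 4 : ℂ) * Complex.I) ^ 2) * hdet'

end NullAnalytic

section NullPairs

open MeasureTheory Set

variable {C D : M2Z}

/-- `α₀` is continuous. [folklore] -/
theorem continuous_alpha0 (C D : M2Z) : Continuous (alpha0 C D) := by unfold alpha0; fun_prop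
/-- `α₂` is continuous. [folklore] -/
theorem continuous_alpha2 (C D : M2Z) : Continuous (alpha2 C D) := by unfold alpha2; fun_prop

/-- **For a rank-2 symmetric pair with `C ≠ 0`, `{Z : |det(CZ + D)| = 1}` is Lebesgue-null.** [folklore] -/
theorem volume_pv_eq_one_null (hP : IsPair C D) (hC : C ≠ 0) :
    volume {x : Fin 6 → ℝ | pv C D x = 1} = 0 := by
  -- invariance of the coefficient functions
  have hα0 : ∀ x t, alpha0 C D (Function.update x 0 t) = alpha0 C D x := fun x t => by
    simp [alpha0, Function.update_of_ne]
  have hβ0 : ∀ x t, beta0 C D (Function.update x 0 t) = beta0 C D x := fun x t => by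
    simp [beta0, alpha0, Function.update_of_ne]
  have hα2 : ∀ x t, alpha2 C D (Function.update x 2 t) = alpha2 C D x := fun x t => by
    simp [alpha2, Function.update_of_ne]
  have hβ2 : ∀ x t, beta2 C D (Function.update x 2 t) = beta2 C D x := fun x t => by
    simp [beta2, alpha2, Function.update_of_ne]
  have hβ1 : ∀ x t, beta1 C D (Function.update x 1 t) = beta1 C D x := fun x t => by
    simp [beta1, Function.update_of_ne]
  have slice0 := slice_null (C := C) (D := D) 0 (alpha0 C D) (beta0 C D)
    (continuous_alpha0 C D).measurable hα0 hβ0 (pairDet_dec0 C D)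
  have slice2 := slice_null (C := C) (D := D) 2 (alpha2 C D) (beta2 C D)
    (continuous_alpha2 C D).measurable hα2 hβ2 (pairDet_dec2 C D)
  by_cases h1 : C 0 0 * C 1 1 - C 0 1 * C 1 0 ≠ 0
  · -- Case A: slice in x₀; the exceptional set {α₀ = 0} lies in a hyperplane x₂ = const
    have h1' : ((C 0 0 : ℝ) * C 1 1 - C 0 1 * C 1 0) ≠ 0 := by exact_mod_cast h1
    have hsub : {x : Fin 6 → ℝ | pv C D x = 1} ⊆
        ({x | pv C D x = 1} ∩ {x | alpha0 C D x ≠ 0}) ∪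
          {x | x 2 = -((C 0 0 * D 1 1 - C 1 0 * D 0 1 : ℤ) : ℝ) / ((C 0 0 * C 1 1 - C 0 1 * C 1 0 : ℤ) : ℝ)} := by
      intro x hx
      by_cases ha : alpha0 C D x = 0
      · right
        have hre := congrArg Complex.re ha
        simp [alpha0] at hre
        simp only [Set.mem_setOf_eq]
        push_cast
        exact (eq_div_iff h1').2 (by linarith)
      · left; exact ⟨hx, ha⟩
    exact measure_mono_null hsub (measure_union_null slice0 (volume_coord_eq_null 2 _))
  · push Not at h1
    by_cases h2 : C 0 0 * D 1 1 - C 1 0 * D 0 1 ≠ 0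
    · -- Case B: α₀ is a nonzero constant
      have hsub : {x : Fin 6 → ℝ | pv C D x = 1} ⊆ {x | pv C D x = 1} ∩ {x | alpha0 C D x ≠ 0} := by
        intro x hx
        refine ⟨hx, ?_⟩
        simp only [Set.mem_setOf_eq, alpha0, h1]
        simp
        exact_mod_cast h2
      exact measure_mono_null hsub slice0
    · push Not at h2
      by_cases h3 : C 1 1 * D 0 0 - C 0 1 * D 1 0 ≠ 0
      · -- Case C: slice in x₂, α₂ a nonzero constant
        have hsub : {x : Fin 6 → ℝ | pv C D x = 1} ⊆ {x | pv C D x = 1} ∩ {x | alpha2 C D x ≠ 0} := by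
          intro x hx
          refine ⟨hx, ?_⟩
          simp only [Set.mem_setOf_eq, alpha2, h1]
          simp
          exact_mod_cast h3
        exact measure_mono_null hsub slice2
      · push Not at h3
        by_cases h4 : alpha1 C D ≠ 0
        · -- Case D: slice in x₁ with the constant α₁
          have slice1 := slice_null (C := C) (D := D) 1 (fun _ => alpha1 C D) (beta1 C D)
            measurable_const (fun _ _ => rfl) hβ1 (pairDet_dec1 C D h1)
          have hsub : {x : Fin 6 → ℝ | pv C D x = 1} ⊆ {x | pv C D x = 1} ∩ {x | alpha1 C D ≠ 0} :=
            fun x hx => ⟨hx, h4⟩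
          exact measure_mono_null hsub slice1
        · -- Case E: impossible, the pair would have rank ≤ 1
          exfalso
          push Not at h4
          have hiso := congrFun (congrFun hP.iso 0) 1
          simp [Matrix.mul_apply, Fin.sum_univ_two] at hiso
          have ha1 : C 1 0 * D 0 0 - C 0 0 * D 1 0 + C 0 1 * D 1 1 - C 1 1 * D 0 1 = 0 := by
            have : (alpha1 C D) = ((C 1 0 * D 0 0 - C 0 0 * D 1 0 + C 0 1 * D 1 1 - C 1 1 * D 0 1 : ℤ) : ℂ) := rfl
            rw [this] at h4; exact_mod_cast h4
          have hδ : C 1 0 * D 0 0 - C 0 0 * D 1 0 = 0 := by linarith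
          obtain ⟨j, k, hjk⟩ := hP.indep
          apply hjk
          by_cases hc : C 0 0 = 0 ∧ C 1 0 = 0
          · -- use w = (C 1 1, -C 0 1)
            have hw : (![C 1 1, -C 0 1] : Fin 2 → ℤ) ≠ 0 := by
              intro h0
              have e1 := congrFun h0 0; have e2 := congrFun h0 1
              simp at e1 e2
              apply hC; ext i j'; fin_cases i <;> fin_cases j' <;> simp [hc.1, hc.2, e1, e2]
            refine minors_eq_zero_of_vecMul hw ?_ j k
            ext (l | l) <;> fin_cases l <;>
              simp [rowMat, Matrix.vecMul, dotProduct, Fin.sum_univ_two, hc.1, hc.2] <;> linarith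
          · have hw : (![C 1 0, -C 0 0] : Fin 2 → ℤ) ≠ 0 := by
              intro h0
              have e1 := congrFun h0 0; have e2 := congrFun h0 1
              simp at e1 e2
              exact hc ⟨e2, e1⟩
            refine minors_eq_zero_of_vecMul hw ?_ j k
            ext (l | l) <;> fin_cases l <;>
              simp [rowMat, Matrix.vecMul, dotProduct, Fin.sum_univ_two] <;> linarith

/-- The first exceptional set: `|det Q_γ(p)| = 1` for some `γ` with `C_γ ≠ 0`. [folklore] -/
def badDet : Set U := {p | ∃ γ : Sp4Z, zC γ ≠ 0 ∧ pv (zC γ) (zD γ) p.1 = 1}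

/-- The first exceptional set is null. [folklore] -/
theorem siegelVolume_badDet : siegelVolume badDet = 0 := by
  have hsub : badDet ⊆ ⋃ γ : Sp4Z, {p : U | zC γ ≠ 0 ∧ pv (zC γ) (zD γ) p.1 = 1} := by
    intro p ⟨γ, h1, h2⟩; exact Set.mem_iUnion.2 ⟨γ, h1, h2⟩
  refine measure_mono_null hsub ((measure_iUnion_null_iff).2 fun γ => ?_)
  by_cases hC : zC γ = 0
  · have : {p : U | zC γ ≠ 0 ∧ pv (zC γ) (zD γ) p.1 = 1} = ∅ := by
      ext p; simp [hC]
    rw [this, measure_empty]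
  · apply siegelVolume_null
    refine measure_mono_null ?_ (volume_pv_eq_one_null (isPair_bottom γ) hC)
    rintro _ ⟨p, ⟨-, hp⟩, rfl⟩
    exact hp

end NullPairs

/-! ### Stage 4b: uniqueness up to `±1` off a null set -/

section Unique

open MeasureTheory Set

variable {x : Fin 6 → ℝ}

/-- From `Z ∈ F₂`: every rank-2 symmetric pair has `|det(CZ + D)|² ≥ 1`. [folklore] -/
theorem pv_ge_one_of_mem_F2 (hx : x ∈ siegelFundamentalDomainTwo) {C D : M2Z} (hP : IsPair C D) :
    1 ≤ pv C D x := by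
  have hcl := hx.2.2.2.2.2.2.2.2 (C 0 0) (C 0 1) (C 1 0) (C 1 1) (D 0 0) (D 0 1) (D 1 0) (D 1 1)
  have hrel : C 0 0 * D 1 0 + C 0 1 * D 1 1 = C 1 0 * D 0 0 + C 1 1 * D 0 1 := by
    have := congrFun (congrFun hP.iso 0) 1
    simp [Matrix.mul_apply, Fin.sum_univ_two] at this
    linarith
  have hmin : C 0 0 * C 1 1 - C 0 1 * C 1 0 ≠ 0 ∨ C 0 0 * D 1 0 - D 0 0 * C 1 0 ≠ 0 ∨
      C 0 0 * D 1 1 - D 0 1 * C 1 0 ≠ 0 ∨ C 0 1 * D 1 0 - D 0 0 * C 1 1 ≠ 0 ∨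
      C 0 1 * D 1 1 - D 0 1 * C 1 1 ≠ 0 ∨ D 0 0 * D 1 1 - D 0 1 * D 1 0 ≠ 0 := by
    obtain ⟨j, k, hjk⟩ := hP.indep
    rcases j with j | j <;> rcases k with k | k <;> fin_cases j <;> fin_cases k <;>
      simp [minor, rowMat] at hjk <;>
      first
        | exact Or.inl (fun h => hjk (by linarith))
        | exact Or.inr (Or.inl (fun h => hjk (by linarith)))
        | exact Or.inr (Or.inr (Or.inl (fun h => hjk (by linarith))))
        | exact Or.inr (Or.inr (Or.inr (Or.inl (fun h => hjk (by linarith)))))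
        | exact Or.inr (Or.inr (Or.inr (Or.inr (Or.inl (fun h => hjk (by linarith))))))
        | exact Or.inr (Or.inr (Or.inr (Or.inr (Or.inr (fun h => hjk (by linarith))))))
  have h1 := hcl hrel hmin
  have heq : pv C D x = ‖pairDet !![C 0 0, C 0 1; C 1 0, C 1 1] !![D 0 0, D 0 1; D 1 0, D 1 1] x‖ ^ 2 := by
    rw [pv, Complex.normSq_eq_norm_sq]
    congr 3 <;> exact (Matrix.etaExpand_eq _).symm
  rw [heq, pairDet_explicit]
  nlinarith [h1]

/-- **The cocycle for `|det Q|²`**: `pv_{δγ}(Z) = pv_δ(γ⟨Z⟩) · pv_γ(Z)`. [folklore] -/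
theorem pv_bottom_mul (δ γ : Sp4Z) (hx : x ∈ U) :
    pv (zC (δ * γ)) (zD (δ * γ)) x = pv (zC δ) (zD δ) (smulVec (toR γ) x) * pv (zC γ) (zD γ) x := by
  rw [pv_bottom, pv_bottom, pv_bottom, map_mul, (smulZ_mul (toR δ) (toR γ) hx).2, Matrix.det_mul,
    Complex.normSq_mul]

/-- `pv` of the bottom rows of `1` is `1`. [folklore] -/
theorem pv_bottom_one (x : Fin 6 → ℝ) : pv (zC 1) (zD 1) x = 1 := by
  have hC : zC 1 = 0 := by
    simp only [zC]; ext i j; simp [Matrix.toBlocks₂₁]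
  have hD : zD 1 = 1 := by
    simp only [zD]; ext i j; fin_cases i <;> fin_cases j <;> simp [Matrix.toBlocks₂₂, Matrix.one_apply]
  rw [hC, hD, pv_zero_one]

/-- (b1) If `p, γ p ∈ F₂` then `|det(C_γ Z + D_γ)| = 1`. [folklore] -/
theorem pv_bottom_eq_one_of_mem {p : U} {γ : Sp4Z} (hp : p.1 ∈ siegelFundamentalDomainTwo)
    (hγp : (γ • p : U).1 ∈ siegelFundamentalDomainTwo) : pv (zC γ) (zD γ) p.1 = 1 := by
  have h1 := pv_ge_one_of_mem_F2 hp (isPair_bottom γ)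
  have h2 := pv_ge_one_of_mem_F2 hγp (isPair_bottom γ⁻¹)
  have hc := pv_bottom_mul γ⁻¹ γ p.2
  rw [inv_mul_cancel, pv_bottom_one] at hc
  rw [coe_sp4Z_smul] at h2
  nlinarith

/-- **Elements with `C = 0` in coordinates**: `Z ↦ A Z Aᵀ + B Aᵀ`. [folklore] -/
theorem toZ_smul_of_zC {γ : Sp4Z} (hC : zC γ = 0) (p : U) :
    toZ (γ • p : U).1 = cZ (zA γ) * toZ p.1 * (cZ (zA γ))ᵀ + cZ (zB γ) * (cZ (zA γ))ᵀ := by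
  have hx := p.2
  obtain ⟨-, -, r3⟩ := row_rel γ
  rw [hC, Matrix.transpose_zero, Matrix.mul_zero, sub_zero] at r3
  have hinv : cZ (zD γ) * (cZ (zA γ))ᵀ = 1 := by
    have : (cZ (zA γ))ᵀ = cZ (zA γ)ᵀ := by ext i j; simp [cZ]
    rw [this, ← cZ_mul]
    have : zD γ * (zA γ)ᵀ = 1 := by
      have := congrArg Matrix.transpose r3
      simpa [Matrix.transpose_mul] using this
    rw [this, cZ_one]
  rw [coe_sp4Z_smul, toZ_smulVec _ hx, smulZ, matP_toR, matQ_toR, hC, cZ_zero, Matrix.zero_mul,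
    zero_add, Matrix.inv_eq_right_inv hinv, Matrix.add_mul, Matrix.mul_assoc]

/-- The coordinates of `γ • p` for `C_γ = 0`, with `A = zA γ`, `B = zB γ`. [folklore] -/
theorem coe_smul_of_zC {γ : Sp4Z} (hC : zC γ = 0) (p : U) :
    let A := zA γ; let B := zB γ
    (γ • p : U).1 3 = p.1 3 * (A 0 0 : ℝ) ^ 2 + 2 * p.1 4 * (A 0 0) * (A 0 1) + p.1 5 * (A 0 1 : ℝ) ^ 2 ∧
    (γ • p : U).1 4 = p.1 3 * (A 0 0 : ℝ) * (A 1 0) + p.1 4 * ((A 0 0 : ℝ) * (A 1 1) + (A 0 1 : ℝ) * (A 1 0)) +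
      p.1 5 * (A 0 1 : ℝ) * (A 1 1) ∧
    (γ • p : U).1 5 = p.1 3 * (A 1 0 : ℝ) ^ 2 + 2 * p.1 4 * (A 1 0) * (A 1 1) + p.1 5 * (A 1 1 : ℝ) ^ 2 ∧
    (γ • p : U).1 0 = p.1 0 * (A 0 0 : ℝ) ^ 2 + 2 * p.1 1 * (A 0 0) * (A 0 1) + p.1 2 * (A 0 1 : ℝ) ^ 2 +
      ((B 0 0 : ℝ) * A 0 0 + (B 0 1 : ℝ) * A 0 1) ∧
    (γ • p : U).1 1 = p.1 0 * (A 0 0 : ℝ) * (A 1 0) + p.1 1 * ((A 0 0 : ℝ) * (A 1 1) + (A 0 1 : ℝ) * (A 1 0)) +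
      p.1 2 * (A 0 1 : ℝ) * (A 1 1) + ((B 0 0 : ℝ) * A 1 0 + (B 0 1 : ℝ) * A 1 1) ∧
    (γ • p : U).1 2 = p.1 0 * (A 1 0 : ℝ) ^ 2 + 2 * p.1 1 * (A 1 0) * (A 1 1) + p.1 2 * (A 1 1 : ℝ) ^ 2 +
      ((B 1 0 : ℝ) * A 1 0 + (B 1 1 : ℝ) * A 1 1) := by
  have key : (γ • p : U).1 = ofZ (toZ (γ • p : U).1) := (ofZ_toZ _).symm
  rw [key, toZ_smul_of_zC hC]
  refine ⟨?_, ?_, ?_, ?_, ?_, ?_⟩ <;>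
    simp [ofZ, Literature.NumberTheory.ModularForms.Sp4Covolume.toZ, Matrix.mul_apply,
      Fin.sum_univ_two] <;> ring

end Unique

section Binary

/-- **Minimum of a reduced binary form**: if `0 ≤ y₁₂`, `2y₁₂ ≤ y₁₁ ≤ y₂₂` then
`Y[m,n] ≥ y₁₁` on `ℤ² ∖ 0`. [folklore] -/
theorem binary_ge {p3 p4 p5 : ℝ} (h4 : 0 ≤ p4) (h43 : 2 * p4 ≤ p3) (h35 : p3 ≤ p5) (m n : ℤ)
    (hmn : (m, n) ≠ (0, 0)) : p3 ≤ p3 * (m : ℝ) ^ 2 + 2 * p4 * m * n + p5 * (n : ℝ) ^ 2 := by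
  have h3 : 0 ≤ p3 := by linarith
  by_cases hn : n = 0
  · subst hn
    have hm : m ≠ 0 := fun h => hmn (by simp [h])
    have hm1 : (1 : ℝ) ≤ (m : ℝ) ^ 2 := by
      have : 1 ≤ |m| := Int.one_le_abs hm
      have h' : (1 : ℝ) ≤ |(m : ℝ)| := by rw [← Int.cast_abs]; exact_mod_cast this
      nlinarith [abs_nonneg (m : ℝ), sq_abs (m : ℝ)]
    simp; nlinarith
  · have hN : (1 : ℝ) ≤ |(n : ℝ)| := by
      rw [← Int.cast_abs]; exact_mod_cast Int.one_le_abs hn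
    by_cases hm : m = 0
    · subst hm; simp
      have : (1 : ℝ) ≤ (n : ℝ) ^ 2 := by nlinarith [abs_nonneg (n : ℝ), sq_abs (n : ℝ)]
      nlinarith
    · have hM : (1 : ℝ) ≤ |(m : ℝ)| := by
        rw [← Int.cast_abs]; exact_mod_cast Int.one_le_abs hm
      set M := |(m : ℝ)| with hMdef
      set N := |(n : ℝ)| with hNdef
      have e1 : (m : ℝ) ^ 2 = M ^ 2 := (sq_abs _).symm
      have e2 : (n : ℝ) ^ 2 = N ^ 2 := (sq_abs _).symm
      have hprod : -(M * N) ≤ (m : ℝ) * n := by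
        rw [hMdef, hNdef, ← abs_mul]; exact neg_abs_le _
      have t1 : -(p3 * (M * N)) ≤ 2 * p4 * m * n := by
        have hMN : 0 ≤ M * N := by positivity
        nlinarith
      have t2 : p3 * N ^ 2 ≤ p5 * (n : ℝ) ^ 2 := by rw [e2]; nlinarith
      rw [e1]
      nlinarith [sq_nonneg (M - N), mul_nonneg (by linarith : (0 : ℝ) ≤ M - 1) (by linarith : (0 : ℝ) ≤ N - 1)]

/-- **Equality in the minimum** (strictly reduced case `y₁₁ < y₂₂`, `y₁₁ > 0`): only `(±1, 0)`. [folklore] -/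
theorem binary_eq_min {p3 p4 p5 : ℝ} (h3 : 0 < p3) (h4 : 0 ≤ p4) (h43 : 2 * p4 ≤ p3) (h35 : p3 < p5)
    (m n : ℤ) (heq : p3 * (m : ℝ) ^ 2 + 2 * p4 * m * n + p5 * (n : ℝ) ^ 2 = p3) :
    n = 0 ∧ (m = 1 ∨ m = -1) := by
  by_cases hn : n = 0
  · subst hn
    refine ⟨rfl, ?_⟩
    simp at heq
    have hm2 : (m : ℝ) ^ 2 = 1 := by
      have : p3 * ((m : ℝ) ^ 2 - 1) = 0 := by linarith
      have := (mul_eq_zero.1 this).resolve_left h3.ne'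
      linarith
    have : |(m : ℝ)| = 1 := by
      rw [← Real.sqrt_sq_eq_abs, hm2, Real.sqrt_one]
    rw [← Int.cast_abs] at this
    have habs : |m| = 1 := by exact_mod_cast this
    exact abs_eq (zero_le_one) |>.1 habs
  · exfalso
    have hN : (1 : ℝ) ≤ |(n : ℝ)| := by
      rw [← Int.cast_abs]; exact_mod_cast Int.one_le_abs hn
    set M := |(m : ℝ)| with hMdef
    set N := |(n : ℝ)| with hNdef
    have e1 : (m : ℝ) ^ 2 = M ^ 2 := (sq_abs _).symm
    have e2 : (n : ℝ) ^ 2 = N ^ 2 := (sq_abs _).symm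
    have hprod : -(M * N) ≤ (m : ℝ) * n := by
      rw [hMdef, hNdef, ← abs_mul]; exact neg_abs_le _
    have hM0 : 0 ≤ M := abs_nonneg _
    have t1 : -(p3 * (M * N)) ≤ 2 * p4 * m * n := by
      have hMN : 0 ≤ M * N := by positivity
      nlinarith
    have t2 : p3 * N ^ 2 < p5 * (n : ℝ) ^ 2 := by
      rw [e2]
      have hN2 : 0 < N ^ 2 := by positivity
      nlinarith [mul_pos (sub_pos.2 h35) hN2]
    rw [e1] at heq
    have key : p3 * (M ^ 2 - M * N + N ^ 2) < p3 := by nlinarith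
    have key2 : 1 ≤ M ^ 2 - M * N + N ^ 2 := by
      by_cases hm : m = 0
      · have hM : M = 0 := by rw [hMdef, hm]; simp
        rw [hM]; nlinarith
      · have hM1 : (1 : ℝ) ≤ M := by
          rw [hMdef, ← Int.cast_abs]; exact_mod_cast Int.one_le_abs hm
        nlinarith [sq_nonneg (M - N), mul_nonneg (by linarith : (0:ℝ) ≤ M - 1) (by linarith : (0:ℝ) ≤ N - 1)]
    nlinarith

/-- **(b3) `A = ±1`**: if `Y` is strictly Minkowski reduced, `A ∈ GL₂(ℤ)` and `A Y Aᵀ` is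
Minkowski reduced, then `A = ±1`. [folklore] -/
theorem A_eq_pm_one {a00 a01 a10 a11 : ℤ}
    (hdet : a00 * a11 - a01 * a10 = 1 ∨ a00 * a11 - a01 * a10 = -1)
    {p3 p4 p5 : ℝ} (h4 : 0 < p4) (h43 : 2 * p4 < p3) (h35 : p3 < p5)
    (hr0 : 0 ≤ p3 * (a00 : ℝ) * a10 + p4 * ((a00 : ℝ) * a11 + (a01 : ℝ) * a10) + p5 * (a01 : ℝ) * a11)
    (hr1 : 2 * (p3 * (a00 : ℝ) * a10 + p4 * ((a00 : ℝ) * a11 + (a01 : ℝ) * a10) + p5 * (a01 : ℝ) * a11) ≤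
      p3 * (a00 : ℝ) ^ 2 + 2 * p4 * a00 * a01 + p5 * (a01 : ℝ) ^ 2)
    (hr2 : p3 * (a00 : ℝ) ^ 2 + 2 * p4 * a00 * a01 + p5 * (a01 : ℝ) ^ 2 ≤
      p3 * (a10 : ℝ) ^ 2 + 2 * p4 * a10 * a11 + p5 * (a11 : ℝ) ^ 2) :
    (a00 = 1 ∧ a01 = 0 ∧ a10 = 0 ∧ a11 = 1) ∨ (a00 = -1 ∧ a01 = 0 ∧ a10 = 0 ∧ a11 = -1) := by
  have h3 : 0 < p3 := by linarith
  set y11 := p3 * (a00 : ℝ) ^ 2 + 2 * p4 * a00 * a01 + p5 * (a01 : ℝ) ^ 2 with hy11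
  set y12 := p3 * (a00 : ℝ) * a10 + p4 * ((a00 : ℝ) * a11 + (a01 : ℝ) * a10) + p5 * (a01 : ℝ) * a11 with hy12
  set y22 := p3 * (a10 : ℝ) ^ 2 + 2 * p4 * a10 * a11 + p5 * (a11 : ℝ) ^ 2 with hy22
  have hdet2 : ((a00 : ℝ) * a11 - a01 * a10) ^ 2 = 1 := by
    rcases hdet with h | h
    · have : (a00 : ℝ) * a11 - a01 * a10 = 1 := by exact_mod_cast h
      rw [this]; norm_num
    · have : (a00 : ℝ) * a11 - a01 * a10 = -1 := by exact_mod_cast h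
      rw [this]; norm_num
  -- (ii) y11 ≥ p3
  have hrow0 : ((a00, a01) : ℤ × ℤ) ≠ (0, 0) := by
    intro h0
    simp only [Prod.mk.injEq] at h0
    rcases hdet with h | h <;> rw [h0.1, h0.2] at h <;> simp at h
  have hii : p3 ≤ y11 := binary_ge h4.le h43.le h35.le a00 a01 hrow0
  -- (iii) p3 = Y'[a11, -a01] ≥ y11
  have hy12nn : 0 ≤ y12 := hr0
  have hvec : ((a11, -a01) : ℤ × ℤ) ≠ (0, 0) := by
    intro h0
    simp only [Prod.mk.injEq, neg_eq_zero] at h0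
    rcases hdet with h | h <;> rw [h0.1, h0.2] at h <;> simp at h
  have hiii' := binary_ge hy12nn (by linarith) hr2 a11 (-a01) hvec
  have hident : y11 * (a11 : ℝ) ^ 2 + 2 * y12 * a11 * ((-a01 : ℤ) : ℝ) + y22 * ((-a01 : ℤ) : ℝ) ^ 2 =
      ((a00 : ℝ) * a11 - a01 * a10) ^ 2 * p3 := by
    simp only [hy11, hy12, hy22]; push_cast; ring
  rw [hident, hdet2, one_mul] at hiii'
  -- so y11 = p3 and the first row is (±1, 0)
  have hy11eq : y11 = p3 := le_antisymm hiii' hii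
  obtain ⟨ha01, ha00⟩ := binary_eq_min h3 h4.le h43.le h35 a00 a01 hy11eq
  -- (iv) second row
  have ha11 : a11 = 1 ∨ a11 = -1 := by
    rcases hdet with h | h <;> rcases ha00 with h' | h' <;> rw [ha01, h'] at h <;> simp at h <;> omega
  have hy12' : y12 = (a00 : ℝ) * (p3 * a10 + p4 * a11) := by
    simp only [hy12, ha01]; push_cast; ring
  have hy11p3 : y11 = p3 := hy11eq
  rw [hy11p3] at hr1
  -- |p3 a10 + p4 a11| ≤ p3 / 2 forces a10 = 0
  have habs : |p3 * (a10 : ℝ) + p4 * a11| ≤ p3 / 2 := by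
    have h1 : |y12| ≤ p3 / 2 := by rw [abs_of_nonneg hy12nn]; linarith
    rw [hy12', abs_mul] at h1
    have : |(a00 : ℝ)| = 1 := by rcases ha00 with h | h <;> simp [h]
    rwa [this, one_mul] at h1
  have ha10 : a10 = 0 := by
    by_contra hne
    have hA : (1 : ℝ) ≤ |(a10 : ℝ)| := by rw [← Int.cast_abs]; exact_mod_cast Int.one_le_abs hne
    have hu : |(a11 : ℝ)| = 1 := by rcases ha11 with h | h <;> simp [h]
    -- |p3 a10 + p4 a11| ≥ p3 |a10| - p4 ≥ p3 - p4 > p3/2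
    have h1 : p3 * |(a10 : ℝ)| - p4 ≤ |p3 * (a10 : ℝ) + p4 * a11| := by
      have := abs_sub_abs_le_abs_sub (p3 * (a10 : ℝ)) (-(p4 * a11))
      rw [sub_neg_eq_add, abs_mul, abs_of_pos h3, abs_neg, abs_mul, abs_of_pos h4, hu, mul_one] at this
      exact this
    nlinarith
  rw [ha10] at hy12'
  simp at hy12'
  -- y12 = a00 a11 p4 ≥ 0 with p4 > 0 ⇒ a00 a11 = 1
  have hsign : 0 ≤ (a00 : ℝ) * a11 := by
    have : 0 ≤ (a00 : ℝ) * (p4 * a11) := by rw [← hy12']; exact hy12nn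
    nlinarith
  rcases ha00 with h0 | h0 <;> rcases ha11 with h1 | h1
  · left; exact ⟨h0, ha01, ha10, h1⟩
  · exfalso; rw [h0, h1] at hsign; norm_num at hsign
  · exfalso; rw [h0, h1] at hsign; norm_num at hsign
  · right; exact ⟨h0, ha01, ha10, h1⟩

end Binary

/-! ### Assembly: `F₂` is a Siegel fundamental domain -/

section Final

open MeasureTheory Set

/-- `det A · det D = 1` when `C = 0`. [folklore] -/
theorem det_zA_mul_det_zD {γ : Sp4Z} (hC : zC γ = 0) : (zA γ).det * (zD γ).det = 1 := by
  obtain ⟨-, -, r3⟩ := row_rel γ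
  rw [hC, Matrix.transpose_zero, Matrix.mul_zero, sub_zero] at r3
  have := congrArg Matrix.det r3
  rwa [Matrix.det_mul, Matrix.det_transpose, Matrix.det_one] at this

/-- `A = ε 1 ⇒ D = ε 1` when `C = 0`. [folklore] -/
theorem zD_eq_of_zA {γ : Sp4Z} (hC : zC γ = 0) {ε : ℤ} (hε : ε = 1 ∨ ε = -1) (hA : zA γ = ε • 1) :
    zD γ = ε • 1 := by
  obtain ⟨-, -, r3⟩ := row_rel γ
  rw [hC, Matrix.transpose_zero, Matrix.mul_zero, sub_zero, hA, Matrix.smul_mul, Matrix.one_mul] at r3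
  -- ε Dᵀ = 1 ⇒ D = ε 1
  have hε2 : ε * ε = 1 := by rcases hε with h | h <;> simp [h]
  have : (zD γ)ᵀ = ε • 1 := by
    have := congrArg (fun M => ε • M) r3
    simp only [smul_smul, hε2, one_smul] at this
    rw [this]
  have := congrArg Matrix.transpose this
  simpa using this

/-- A symplectic matrix with blocks `(ε1, 0; 0, ·)` is `±1`. [folklore] -/
theorem eq_pm_one_of_blocks {γ : Sp4Z} (hC : zC γ = 0) {ε : ℤ} (hε : ε = 1 ∨ ε = -1)
    (hA : zA γ = ε • 1) (hB : zB γ = 0) : γ = 1 ∨ γ = -1 := by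
  have hD := zD_eq_of_zA hC hε hA
  have hγ : (γ : Matrix (Fin 2 ⊕ Fin 2) (Fin 2 ⊕ Fin 2) ℤ) = ε • 1 := by
    rw [eq_fromBlocks_z, hA, hB, hC, hD, ← Matrix.fromBlocks_one, Matrix.fromBlocks_smul]
    simp
  rcases hε with h | h
  · left; apply Subtype.ext; rw [hγ, h, one_smul]; rfl
  · right; apply Subtype.ext; rw [hγ, h, coe_neg_Sp4Z]; simp

/-- An integer shift preserving `[-1/2, 1/2]` strictly inside is zero. [folklore] -/
theorem int_shift_eq_zero {t : ℝ} {k : ℤ} (ht : |t| < 1 / 2) (h : |t + k| ≤ 1 / 2) : k = 0 := by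
  have h1 : |(k : ℝ)| < 1 := by
    have h2 : |(k : ℝ)| ≤ |t + k| + |t| := by
      have := abs_sub (t + k) t
      rwa [add_sub_cancel_left] at this
    linarith
  obtain ⟨h3, h4⟩ := abs_lt.1 h1
  have h3' : (-1 : ℤ) < k := by exact_mod_cast h3
  have h4' : k < 1 := by exact_mod_cast h4
  omega

/-- The full exceptional set for uniqueness. [folklore] -/
def badAll : Set U :=
  badDet ∪ {p | p.1 4 = 0} ∪ {p | p.1 4 = (1 / 2) * p.1 3} ∪ {p | p.1 3 = 1 * p.1 5} ∪
    {p | p.1 0 = 1 / 2} ∪ {p | p.1 0 = -(1 / 2)} ∪ {p | p.1 1 = 1 / 2} ∪ {p | p.1 1 = -(1 / 2)} ∪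
    {p | p.1 2 = 1 / 2} ∪ {p | p.1 2 = -(1 / 2)}

/-- Coordinate hyperplanes are `siegelVolume`-null. [folklore] -/
theorem siegelVolume_coord_eq (i : Fin 6) (c : ℝ) : siegelVolume {p : U | p.1 i = c} = 0 := by
  apply siegelVolume_null
  refine measure_mono_null ?_ (volume_coord_eq_null i c)
  rintro _ ⟨p, hp, rfl⟩; exact hp

/-- Coordinate hyperplanes are `siegelVolume`-null. [folklore] -/
theorem siegelVolume_coord_eq_mul {i j : Fin 6} (hij : i ≠ j) (a : ℝ) :
    siegelVolume {p : U | p.1 i = a * p.1 j} = 0 := by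
  apply siegelVolume_null
  refine measure_mono_null ?_ (volume_coord_eq_mul_null hij a)
  rintro _ ⟨p, hp, rfl⟩; exact hp

/-- The full exceptional set is null. [folklore] -/
theorem siegelVolume_badAll : siegelVolume badAll = 0 := by
  unfold badAll
  refine measure_union_null (measure_union_null (measure_union_null (measure_union_null
    (measure_union_null (measure_union_null (measure_union_null (measure_union_null
    (measure_union_null siegelVolume_badDet (siegelVolume_coord_eq 4 0))
    (siegelVolume_coord_eq_mul (by decide) _)) (siegelVolume_coord_eq_mul (by decide) _))
    (siegelVolume_coord_eq 0 _)) (siegelVolume_coord_eq 0 _)) (siegelVolume_coord_eq 1 _))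
    (siegelVolume_coord_eq 1 _)) (siegelVolume_coord_eq 2 _)) (siegelVolume_coord_eq 2 _)

/-- **Uniqueness** (Klingen I.3 Thm. 2 / Siegel): off a null set, `p, γ p ∈ F₂` forces `γ = ±1`. [folklore] -/
theorem ae_unique_F2 : ∀ᵐ p ∂siegelVolume, p ∈ (Subtype.val ⁻¹' siegelFundamentalDomainTwo : Set U) →
    ∀ γ ∈ (⊤ : Subgroup Sp4Z), γ • p ∈ (Subtype.val ⁻¹' siegelFundamentalDomainTwo : Set U) →
      γ = 1 ∨ γ = -1 := by
  have hae : ∀ᵐ p ∂siegelVolume, p ∉ badAll := by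
    rw [ae_iff]; simpa using siegelVolume_badAll
  filter_upwards [hae] with p hp hpF γ _ hγF
  simp only [badAll, Set.mem_union, Set.mem_setOf_eq, not_or] at hp
  obtain ⟨⟨⟨⟨⟨⟨⟨⟨⟨hbd, h4ne⟩, h43ne⟩, h35ne⟩, h0a⟩, h0b⟩, h1a⟩, h1b⟩, h2a⟩, h2b⟩ := hp
  simp only [Set.mem_preimage] at hpF hγF
  -- (b1): C_γ = 0
  have hpv := pv_bottom_eq_one_of_mem hpF hγF
  have hC : zC γ = 0 := by
    by_contra hC; exact hbd ⟨γ, hC, hpv⟩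
  -- strict reduction at p
  obtain ⟨hx3, hxD, hx0, hx1, hx2, hx4, hx43, hx35, -⟩ := hpF
  have hx4' : 0 < p.1 4 := lt_of_le_of_ne hx4 (Ne.symm h4ne)
  have hx43' : 2 * p.1 4 < p.1 3 := lt_of_le_of_ne hx43 (fun h => h43ne (by linarith))
  have hx35' : p.1 3 < p.1 5 := lt_of_le_of_ne hx35 (fun h => h35ne (by linarith))
  have hx0' : |p.1 0| < 1 / 2 := lt_of_le_of_ne hx0 (fun h => by
    rcases abs_eq (by norm_num : (0:ℝ) ≤ 1/2) |>.1 h with h' | h' <;> [exact h0a h'; exact h0b h'])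
  have hx1' : |p.1 1| < 1 / 2 := lt_of_le_of_ne hx1 (fun h => by
    rcases abs_eq (by norm_num : (0:ℝ) ≤ 1/2) |>.1 h with h' | h' <;> [exact h1a h'; exact h1b h'])
  have hx2' : |p.1 2| < 1 / 2 := lt_of_le_of_ne hx2 (fun h => by
    rcases abs_eq (by norm_num : (0:ℝ) ≤ 1/2) |>.1 h with h' | h' <;> [exact h2a h'; exact h2b h'])
  -- reduction at γ p
  obtain ⟨-, -, hy0, hy1, hy2, hy4, hy43, hy35, -⟩ := hγF
  obtain ⟨e3, e4, e5, e0, e1, e2⟩ := coe_smul_of_zC hC p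
  -- (b3): A = ±1
  have hdet : zA γ 0 0 * zA γ 1 1 - zA γ 0 1 * zA γ 1 0 = 1 ∨ zA γ 0 0 * zA γ 1 1 - zA γ 0 1 * zA γ 1 0 = -1 := by
    have h := det_zA_mul_det_zD hC
    have hu := Int.isUnit_iff.1 (IsUnit.of_mul_eq_one _ h)
    rw [Matrix.det_fin_two] at hu; exact hu
  rw [e4] at hy4; rw [e4, e3] at hy43; rw [e3, e5] at hy35
  have hA := A_eq_pm_one hdet hx4' hx43' hx35' (by linarith) (by linarith) (by linarith)
  -- (b4): B = 0 and conclusion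
  obtain ⟨r1, -, -⟩ := row_rel γ
  rcases hA with ⟨a00, a01, a10, a11⟩ | ⟨a00, a01, a10, a11⟩
  · have hAeq : zA γ = (1 : ℤ) • 1 := by
      ext i j; fin_cases i <;> fin_cases j <;> simp [a00, a01, a10, a11]
    rw [hAeq, one_smul, Matrix.one_mul, Matrix.transpose_one, Matrix.mul_one] at r1
    -- r1 : Bᵀ = B
    simp only [a00, a01, a10, a11] at e0 e1 e2
    rw [e0] at hy0; rw [e1] at hy1; rw [e2] at hy2
    have hb00 : zB γ 0 0 = 0 := int_shift_eq_zero hx0' (by convert hy0 using 2; push_cast; ring)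
    have hb01 : zB γ 0 1 = 0 := int_shift_eq_zero hx1' (by convert hy1 using 2; push_cast; ring)
    have hb11 : zB γ 1 1 = 0 := int_shift_eq_zero hx2' (by convert hy2 using 2; push_cast; ring)
    have hb10 : zB γ 1 0 = 0 := by
      have := congrFun (congrFun r1 0) 1
      simp [Matrix.transpose_apply] at this
      exact this.trans hb01
    have hB : zB γ = 0 := by
      ext i j; fin_cases i <;> fin_cases j <;> simp [hb00, hb01, hb10, hb11]
    exact eq_pm_one_of_blocks hC (Or.inl rfl) hAeq hB
  · have hAeq : zA γ = (-1 : ℤ) • 1 := by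
      ext i j; fin_cases i <;> fin_cases j <;> simp [a00, a01, a10, a11]
    rw [hAeq, Matrix.smul_mul, Matrix.one_mul, Matrix.transpose_smul, Matrix.transpose_one,
      Matrix.mul_smul, Matrix.mul_one] at r1
    have r1' : (zB γ)ᵀ = zB γ := by
      have := congrArg (fun M => (-1 : ℤ) • M) r1
      simpa [smul_smul] using this
    simp only [a00, a01, a10, a11] at e0 e1 e2
    rw [e0] at hy0; rw [e1] at hy1; rw [e2] at hy2
    have hb00 : -zB γ 0 0 = 0 := int_shift_eq_zero hx0' (by convert hy0 using 2; push_cast; ring)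
    have hb01 : -zB γ 0 1 = 0 := int_shift_eq_zero hx1' (by convert hy1 using 2; push_cast; ring)
    have hb11 : -zB γ 1 1 = 0 := int_shift_eq_zero hx2' (by convert hy2 using 2; push_cast; ring)
    have hb10 : zB γ 1 0 = zB γ 0 1 := by
      have := congrFun (congrFun r1' 0) 1
      simpa [Matrix.transpose_apply] using this
    have hB : zB γ = 0 := by
      ext i j; fin_cases i <;> fin_cases j <;> simp <;> omega
    exact eq_pm_one_of_blocks hC (Or.inr rfl) hAeq hB

end Final

end Literature.NumberTheory.ModularForms.Sp4Covolume
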